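import Literature.NumberTheory.LFunctions.LogFreeDensityDHZeroSide
import Literature.NumberTheory.LFunctions.LogFreeDensityTheorem14Zeta
import HarnessLib

/-!
# Bombieri's Théorème 14, second assertion: the zero sides for `χ = χ₁` and for `ζ`

Topic `Literature/NumberTheory/LFunctions`, sub-namespace `LogFreeDensity`. Everything here is
PROVED (theorems only; no definitions, no named facts). Reproduction of published work:
E. Bombieri, *Le grand crible dans la théorie analytique des nombres*, Astérisque 18 (2ᵉ éd. 1987),
§6, THÉORÈME 14, "deuxième cas" (pp. 43–50), the two configurations not covered by
`LogFreeDensityDHZeroSide.lean`: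

* (D3) the term `q = 1` (the zeros of `ζ`): `F(s) = ζ₁'/ζ₁(s) + L'/L(s + δ₁, χ₁)`
  (`LogFreeDensity.iteratedDeriv_add_D3`), whose Dirichlet series has the weights
  `w = Λ(1 + χ₁ n^{−δ₁})/2` (`LogFreeDensity.dhW`) and the trivial character; the pole of `ζ` at
  `s = 1` contributes `(−1)^k k!/(s₀ − 1)^{k+1}`, which is harmless at heights `|v| ≥ 1/2`
  (`lemmeA_D3`, `lemmeB_D3`, `zeroSide_D3`, the last for zeros at heights `|γ| ≥ 3 + r/2` as in
  the tree's `LogFreeDensity.zeroSideZeta`);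
* (D2) the exceptional character itself, `χ = χ₁`: `F(s) = L'/L(s, χ₁) + ζ₁'/ζ₁(s + δ₁) − 1/(s − β₁)`
  (`LogFreeDensity.iteratedDeriv_add_D2`): the simple zero `β₁` of `L(s, χ₁)` is cancelled by the
  pole of `ζ(s + δ₁)` at `s = 1 − δ₁ = β₁`, so Lemme A detects every OTHER zero of `L(s, χ₁)` near
  `1 + iv`; the weights are `w₀ = Λ(χ₁ + n^{−δ₁})/2` (`LogFreeDensity.dhW₀`) with the trivial
  character (`lemmeA_D2`, `lemmeB_D2`, `zeroSide_D2`; the simplicity `m(β₁) ≤ 1` is a hypothesis,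
  supplied in the assembly from the zero-free region).

The abstract Turán step is the tree's `LogFreeDensity.lemmeA_abstract`; the local inputs are the
tree's Lemme de densité and Cauchy estimates for `L(s, χ)` (`LogFreeDensityLocal.lean`) and for
`ζ₁ = (s − 1)ζ` (`LogFreeDensityZetaLocal.lean`).

## References
* [Bombieri1987GrandCrible] E. Bombieri, *Le grand crible dans la théorie analytique des nombres*,
  Astérisque 18 (1987), §6, Lemme A (pp. 43–45), Lemme B (pp. 46–48), Théorème 14 (pp. 48–52).
-/

noncomputable section

open Complex Finset Filter Real MeasureTheory Metric
open scoped LSeries.notation ArithmeticFunction.vonMangoldt Topology Nat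

namespace Literature.NumberTheory.LFunctions.LogFreeDensity

open Literature.NumberTheory.LFunctions Literature.NumberTheory.LFunctions.DirichletDisc
  Literature.NumberTheory.LFunctions.DirichletZFR

/-! ### Small tools -/

/-- Off `zetaDiscZeros v` the divisor weight of `ζ₁` vanishes. [folklore] -/
theorem zetaDiscDivisor_eq_zero_of_notMem (v : ℝ) {ρ : ℂ} (h : ρ ∉ zetaDiscZeros v) :
    zetaDiscDivisor v ρ = 0 := by
  rw [zetaDiscZeros, Set.Finite.mem_toFinset, Function.mem_support, not_not] at h
  exact h

/-- `s₀ + d` with `s₀ = 1 + r + iv`, `0 ≤ d`, `r + d ≤ 1`, lies in the disc `|s − (2 + iv)| ≤ 8/5`.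
[folklore] -/
theorem add_mem_closedBall_two_zeta {r d v : ℝ} (hr : 0 < r) (hd : 0 ≤ d) (hrd : r + d ≤ 1) :
    ((1 + r : ℝ) : ℂ) + (v : ℂ) * I + (d : ℂ) ∈ closedBall (2 + (v : ℂ) * I) (8 / 5) := by
  rw [Metric.mem_closedBall, dist_eq_norm]
  have h : ((1 + r : ℝ) : ℂ) + (v : ℂ) * I + (d : ℂ) - (2 + (v : ℂ) * I) = ((r + d - 1 : ℝ) : ℂ) := by
    push_cast; ring
  rw [h, Complex.norm_real, Real.norm_eq_abs, abs_le]
  constructor <;> linarith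

/-- The pole term `(−1)^k k!/(s₀ − b)^{k+1}` is at most `k! 16^k · 2` in norm once `|s₀ − b| ≥ 1/2`.
[folklore] -/
theorem norm_poleTerm_le {s₀ b : ℂ} (h : 1 / 2 ≤ ‖s₀ - b‖) (k : ℕ) :
    ‖(-1 : ℂ) ^ k * k.factorial * (1 / (s₀ - b) ^ (k + 1))‖ ≤ k.factorial * 16 ^ k * 2 := by
  have hpos : 0 < ‖s₀ - b‖ := lt_of_lt_of_le (by norm_num) h
  rw [norm_mul, norm_mul, norm_pow, norm_neg, norm_one, one_pow, one_mul, Complex.norm_natCast,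
    norm_div, norm_one, norm_pow]
  have h1 : 1 / ‖s₀ - b‖ ^ (k + 1) ≤ 2 ^ (k + 1) := by
    rw [div_le_iff₀ (by positivity)]
    have : (1 : ℝ) ≤ (2 * ‖s₀ - b‖) ^ (k + 1) := one_le_pow₀ (by linarith)
    calc (1 : ℝ) ≤ (2 * ‖s₀ - b‖) ^ (k + 1) := this
      _ = 2 ^ (k + 1) * ‖s₀ - b‖ ^ (k + 1) := by rw [mul_pow]
  have h2 : (2 : ℝ) ^ (k + 1) ≤ 16 ^ k * 2 := by
    rw [pow_succ]
    exact mul_le_mul_of_nonneg_right (pow_le_pow_left₀ (by norm_num) (by norm_num) k) (by norm_num)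
  calc (k.factorial : ℝ) * (1 / ‖s₀ - b‖ ^ (k + 1)) ≤ k.factorial * 2 ^ (k + 1) :=
        mul_le_mul_of_nonneg_left h1 (by positivity)
    _ ≤ k.factorial * (16 ^ k * 2) := mul_le_mul_of_nonneg_left h2 (by positivity)
    _ = k.factorial * 16 ^ k * 2 := by ring

/-- The norm of the main term of the (D1)–(D3) identities:
`‖(−1)^{k+1} (k! r^{−k} (2 S))‖ = k! (r^{−k} (2‖S‖))`. [folklore] -/
theorem norm_mainTerm_eq {r : ℝ} (hr : 0 < r) (k : ℕ) (S : ℂ) :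
    ‖(-1 : ℂ) ^ (k + 1) * ((k.factorial : ℂ) * (r⁻¹ : ℂ) ^ k * (2 * S))‖ =
      k.factorial * (r⁻¹ ^ k * (2 * ‖S‖)) := by
  rw [norm_mul, norm_pow, norm_neg, norm_one, one_pow, one_mul, norm_mul, norm_mul, norm_mul,
    Complex.norm_natCast, norm_pow, norm_inv, Complex.norm_real, Real.norm_eq_abs,
    abs_of_pos hr, Complex.norm_ofNat]
  ring

/-- From `e^{−10K}(2r)^{−(k+1)} ≤ ‖main‖/k!` to the hypothesis of `lemmeB_generic` with `η = 2`.
[folklore] -/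
theorem hAout_of_mainTerm {K k : ℕ} {r : ℝ} (hr : 0 < r) (S : ℂ)
    (hb : Real.exp (-(10 * K)) * (2 * r)⁻¹ ^ (k + 1) ≤
      ‖(-1 : ℂ) ^ (k + 1) * ((k.factorial : ℂ) * (r⁻¹ : ℂ) ^ k * (2 * S))‖ / k.factorial) :
    Real.exp (-(10 * K)) * (2⁻¹ ^ (k + 1) / r) ≤ 2 * ‖S‖ := by
  rw [norm_mainTerm_eq hr k S] at hb
  have hb' : Real.exp (-(10 * K)) * (2 * r)⁻¹ ^ (k + 1) / 1 ≤ 2 * (r⁻¹ ^ k * ‖S‖) := by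
    have : (k.factorial : ℝ) * (r⁻¹ ^ k * (2 * ‖S‖)) / k.factorial = 2 * (r⁻¹ ^ k * ‖S‖) := by
      field_simp
    rw [div_one]
    exact hb.trans this.le
  have h2 := hmain_of_lemmaA (K := K) (k := k) (c := 1) (S := ‖S‖) hr one_pos hb'
  simpa using h2

/-! ### (D3) Lemme A for `F = ζ₁'/ζ₁(s) + L'/L(s + δ₁, χ₁)` -/

set_option maxHeartbeats 1600000 in
/-- **Lemme A in the Deuring–Heilbronn case, configuration (D3)** (Bombieri, *Le grand crible*, §6,
p. 43, the term `q = 1`): there is an absolute `c₄ > 0` such that for `χ₁ ≠ χ₀` mod `q₁`, `0 ≤ δ₁`,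
`log q₁ + log(|v|+4) ≤ L'`, `δ₁ L' ≤ 1`, `1/2 ≤ |v|`, `0 < r`, `512 r ≤ 1/8`, `rL' ≥ 1`, if `ζ`
has a zero `ρ₀` with `|ρ₀ − (1 + iv)| ≤ r`, then for every `K ≥ c₄ rL' + 2` there is
`k ∈ [K, 2K]` with
`e^{−10K}(2r)^{−(k+1)} ≤ (1/k!)‖(ζ₁'/ζ₁)^{(k)}(s₀) + (L'/L)^{(k)}(s₀ + δ₁, χ₁) − (−1)^k k!/(s₀ − 1)^{k+1}‖`,
`s₀ = 1 + r + iv`. [cite: Bombieri1987GrandCrible, §6 Lemme A] -/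
theorem lemmeA_D3 :
    ∃ c₄ : ℝ, 0 < c₄ ∧
      ∀ (q₁ : ℕ) [NeZero q₁] (χ₁ : DirichletCharacter ℂ q₁), χ₁ ≠ 1 →
      ∀ (δ₁ v r L' : ℝ), 0 ≤ δ₁ →
        Real.log q₁ + Real.log (|v| + 4) ≤ L' → δ₁ * L' ≤ 1 → 1 / 2 ≤ |v| →
        0 < r → 512 * r ≤ 1 / 8 → 1 ≤ r * L' →
        (∃ ρ₀ ∈ zetaDiscZeros v, ‖ρ₀ - (1 + (v : ℂ) * I)‖ ≤ r) →
        ∀ K : ℕ, c₄ * (r * L') + 2 ≤ K →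
          ∃ k ∈ Finset.Icc K (2 * K),
            Real.exp (-(10 * K)) * (2 * r)⁻¹ ^ (k + 1) ≤
              ‖iteratedDeriv k (logDeriv riemannZeta₁) (((1 + r : ℝ) : ℂ) + (v : ℂ) * I) +
                iteratedDeriv k (logDeriv χ₁.LFunction) (((1 + r : ℝ) : ℂ) + (v : ℂ) * I + δ₁) -
                (-1) ^ k * k.factorial *
                  (1 / (((1 + r : ℝ) : ℂ) + (v : ℂ) * I - 1) ^ (k + 1))‖ / k.factorial := by
  obtain ⟨C_d, hC_d, hdens⟩ := exists_sum_near_le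
  obtain ⟨C_J, hC_J, hjensen⟩ := exists_sum_discZeros_le
  obtain ⟨C₁, hC₁, hderiv⟩ := exists_norm_iteratedDeriv_logDeriv_sub_le
  obtain ⟨C_dζ, hC_dζ, hdensζ⟩ := exists_sum_near_le_zeta
  obtain ⟨C_Jζ, hC_Jζ, hjensenζ⟩ := exists_sum_zetaDiscZeros_le
  obtain ⟨C₁ζ, hC₁ζ, hderivζ⟩ := exists_norm_iteratedDeriv_logDeriv_sub_le_zeta
  obtain ⟨c₄, hc₄, hA⟩ := lemmeA_abstract (C_d := C_dζ + 2 * C_d + 8 * C_J) (C_J := C_Jζ + C_J)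
    (C₁ := C₁ζ + C₁ + 2) (by positivity) (by positivity) (by positivity)
  refine ⟨c₄, hc₄, fun q₁ _ χ₁ hχ₁ δ₁ v r L' hδ hLχ hδL hv hr hr8 hu hzero K hK => ?_⟩
  classical
  set w : ℂ := 1 + (v : ℂ) * I with hw
  set s₀ : ℂ := ((1 + r : ℝ) : ℂ) + (v : ℂ) * I with hs₀
  set Z₁ := zetaDiscZeros v with hZ₁
  set Zχ := discZeros χ₁ v with hZχ
  set Z₂ := Zχ.image (fun ρ' : ℂ => ρ' - (δ₁ : ℂ)) with hZ₂
  set Z := Z₁ ∪ Z₂ with hZ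
  set D₁ : ℂ → ℤ := fun ρ => zetaDiscDivisor v ρ with hD₁
  set D₂ : ℂ → ℤ := fun ρ => discDivisor χ₁ v (ρ + (δ₁ : ℂ)) with hD₂
  set D : ℂ → ℤ := fun ρ => D₁ ρ + D₂ ρ with hD
  set a : ℕ → ℂ := fun k => iteratedDeriv k (logDeriv riemannZeta₁) s₀ +
    iteratedDeriv k (logDeriv χ₁.LFunction) (s₀ + δ₁) -
    (-1) ^ k * k.factorial * (1 / (s₀ - 1) ^ (k + 1)) with ha
  -- basic sizes
  have hℒv1 : 1 ≤ Real.log (|v| + 4) := ClassicalZFRData.one_le_log_tau v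
  have hlogq0 : 0 ≤ Real.log q₁ := Real.log_natCast_nonneg _
  have hLv : Real.log (|v| + 4) ≤ L' := by linarith
  have hL'1 : 1 ≤ L' := hℒv1.trans hLv
  have hr0 : r ≤ 1 / 4096 := by linarith
  have hL'big : 4096 ≤ L' := by
    by_contra h
    push Not at h
    nlinarith [mul_lt_mul_of_pos_left h hr]
  have hδsmall : δ₁ ≤ 1 / 4096 := by
    have h1 : δ₁ * 4096 ≤ δ₁ * L' := mul_le_mul_of_nonneg_left hL'big hδ
    nlinarith
  -- vanishing of the weights off their supports
  have hD₁0 : ∀ ρ, ρ ∉ Z₁ → D₁ ρ = 0 := fun ρ h => zetaDiscDivisor_eq_zero_of_notMem v h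
  have hD₂0 : ∀ ρ, ρ ∉ Z₂ → D₂ ρ = 0 := by
    intro ρ h
    apply discDivisor_eq_zero_of_notMem χ₁ v
    intro hmem
    apply h
    rw [hZ₂, Finset.mem_image]
    exact ⟨ρ + δ₁, hmem, by ring⟩
  have hD₁nn : ∀ ρ, 0 ≤ D₁ ρ := fun ρ => zetaDiscDivisor_nonneg v ρ
  have hD₂nn : ∀ ρ, 0 ≤ D₂ ρ := fun ρ => discDivisor_nonneg hχ₁ v _
  have hDnn : ∀ ρ, 0 ≤ D ρ := fun ρ => add_nonneg (hD₁nn ρ) (hD₂nn ρ)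
  have hinj : Set.InjOn (fun ρ' : ℂ => ρ' - (δ₁ : ℂ)) (Zχ : Set ℂ) :=
    fun a _ b _ h => by simpa using h
  -- (1) the points of `Z` have `Re < 1` and weight `≥ 1`
  have hZprop : ∀ ρ ∈ Z, ρ.re < 1 ∧ (1 : ℝ) ≤ D ρ := by
    intro ρ hρ
    rw [hZ, Finset.mem_union] at hρ
    rcases hρ with h1 | h2
    · obtain ⟨-, -, -, -, hdiv, hm⟩ := zetaDiscZeros_prop h1
      refine ⟨zeta_re_lt_one_of_mem h1, ?_⟩
      have : (1 : ℤ) ≤ D₁ ρ := by rw [hD₁]; dsimp only; rw [hdiv]; exact_mod_cast hm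
      have h2 := hD₂nn ρ
      simp only [hD]; push_cast; exact_mod_cast (by omega : (1:ℤ) ≤ D₁ ρ + D₂ ρ)
    · rw [hZ₂, Finset.mem_image] at h2
      obtain ⟨ρ', hρ', rfl⟩ := h2
      obtain ⟨-, -, -, hre, hdiv, hm⟩ := discZeros_prop hχ₁ hρ'
      refine ⟨by simp; linarith, ?_⟩
      have : (1 : ℤ) ≤ D₂ (ρ' - δ₁) := by
        rw [hD₂]; dsimp only; rw [sub_add_cancel, hdiv]; exact_mod_cast hm
      have h1 := hD₁nn (ρ' - δ₁)
      simp only [hD]; push_cast; exact_mod_cast (by omega : (1:ℤ) ≤ D₁ (ρ' - δ₁) + D₂ (ρ' - δ₁))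
  -- (2) the local count
  have hloc : ∀ lam : ℝ, 0 < lam → lam ≤ 1 / 4 →
      ∑ ρ ∈ Z.filter (fun ρ => ‖ρ - (1 + (v : ℂ) * I)‖ ≤ lam), (D ρ : ℝ) ≤
        (C_dζ + 2 * C_d + 8 * C_J) * (1 + lam * L') := by
    intro lam hlam hlam4
    set P : ℂ → Prop := fun ρ => ‖ρ - (1 + (v : ℂ) * I)‖ ≤ lam with hP
    have hsplit : ∑ ρ ∈ Z.filter P, (D ρ : ℝ) =
        ∑ ρ ∈ Z.filter P, (D₁ ρ : ℝ) + ∑ ρ ∈ Z.filter P, (D₂ ρ : ℝ) := by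
      rw [← Finset.sum_add_distrib]
      refine Finset.sum_congr rfl fun ρ _ => ?_
      simp only [hD]; push_cast; ring
    have h1 : ∑ ρ ∈ Z.filter P, (D₁ ρ : ℝ) = ∑ ρ ∈ Z₁.filter P, (D₁ ρ : ℝ) := by
      symm
      apply Finset.sum_subset
      · exact Finset.filter_subset_filter _ (Finset.subset_union_left)
      · intro ρ hρ hρ'
        have : ρ ∉ Z₁ := fun h => hρ' (Finset.mem_filter.2 ⟨h, (Finset.mem_filter.1 hρ).2⟩)
        rw [hD₁0 ρ this]; simp
    have h1b : ∑ ρ ∈ Z₁.filter P, (D₁ ρ : ℝ) ≤ C_dζ * (1 + lam * L') := by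
      refine (hdensζ v lam hlam hlam4).trans ?_
      have : lam * Real.log (|v| + 4) ≤ lam * L' := mul_le_mul_of_nonneg_left hLv hlam.le
      nlinarith
    have h2 : ∑ ρ ∈ Z.filter P, (D₂ ρ : ℝ) = ∑ ρ ∈ Z₂.filter P, (D₂ ρ : ℝ) := by
      symm
      apply Finset.sum_subset
      · exact Finset.filter_subset_filter _ (Finset.subset_union_right)
      · intro ρ hρ hρ'
        have : ρ ∉ Z₂ := fun h => hρ' (Finset.mem_filter.2 ⟨h, (Finset.mem_filter.1 hρ).2⟩)
        rw [hD₂0 ρ this]; simp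
    have h2' : ∑ ρ ∈ Z₂.filter P, (D₂ ρ : ℝ) =
        ∑ ρ' ∈ Zχ.filter (fun ρ' => P (ρ' - δ₁)), (discDivisor χ₁ v ρ' : ℝ) := by
      rw [hZ₂, Finset.filter_image, Finset.sum_image (hinj.mono (by
        intro x hx; exact (Finset.mem_filter.1 hx).1))]
      refine Finset.sum_congr rfl fun ρ' _ => ?_
      simp only [hD₂, sub_add_cancel]
    have h2b : ∑ ρ' ∈ Zχ.filter (fun ρ' => P (ρ' - δ₁)), (discDivisor χ₁ v ρ' : ℝ) ≤
        (2 * C_d + 8 * C_J) * (1 + lam * L') := by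
      by_cases hcase : lam + δ₁ ≤ 1 / 4
      · have hsub : Zχ.filter (fun ρ' => P (ρ' - δ₁)) ⊆
            Zχ.filter (fun ρ' => ‖ρ' - (1 + (v : ℂ) * I)‖ ≤ lam + δ₁) := by
          intro ρ' hρ'
          rw [Finset.mem_filter] at hρ' ⊢
          refine ⟨hρ'.1, ?_⟩
          have hP' : ‖ρ' - (δ₁ : ℂ) - (1 + (v : ℂ) * I)‖ ≤ lam := hρ'.2
          calc ‖ρ' - (1 + (v : ℂ) * I)‖ = ‖(ρ' - (δ₁ : ℂ) - (1 + (v : ℂ) * I)) + (δ₁ : ℂ)‖ := by ring_nf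
            _ ≤ ‖ρ' - (δ₁ : ℂ) - (1 + (v : ℂ) * I)‖ + ‖(δ₁ : ℂ)‖ := norm_add_le _ _
            _ ≤ lam + δ₁ := by
                rw [Complex.norm_real, Real.norm_eq_abs, abs_of_nonneg hδ]; linarith
        calc ∑ ρ' ∈ Zχ.filter (fun ρ' => P (ρ' - δ₁)), (discDivisor χ₁ v ρ' : ℝ)
            ≤ ∑ ρ' ∈ Zχ.filter (fun ρ' => ‖ρ' - (1 + (v : ℂ) * I)‖ ≤ lam + δ₁),
                (discDivisor χ₁ v ρ' : ℝ) :=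
              Finset.sum_le_sum_of_subset_of_nonneg hsub fun ρ' _ _ => by
                exact_mod_cast discDivisor_nonneg hχ₁ v ρ'
          _ ≤ C_d * (1 + (lam + δ₁) * (Real.log q₁ + Real.log (|v| + 4))) :=
              hdens q₁ χ₁ hχ₁ v (lam + δ₁) (by linarith) hcase
          _ ≤ C_d * (1 + (lam + δ₁) * L') := by
              have : (lam + δ₁) * (Real.log q₁ + Real.log (|v| + 4)) ≤ (lam + δ₁) * L' :=
                mul_le_mul_of_nonneg_left hLχ (by linarith)
              nlinarith
          _ ≤ C_d * (2 + lam * L') := by nlinarith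
          _ ≤ (2 * C_d + 8 * C_J) * (1 + lam * L') := by
              have hlamL : 0 ≤ lam * L' := by positivity
              nlinarith [mul_nonneg hC_d.le hlamL, mul_nonneg hC_J.le hlamL]
      · push Not at hcase
        have hlam8 : 1 / 8 ≤ lam := by linarith
        have hCL : 0 ≤ C_J * L' := by positivity
        have h8 : C_J * L' ≤ C_J * L' * (8 * lam) := le_mul_of_one_le_right hCL (by linarith)
        have hlamL : 0 ≤ lam * L' := by positivity
        calc ∑ ρ' ∈ Zχ.filter (fun ρ' => P (ρ' - δ₁)), (discDivisor χ₁ v ρ' : ℝ)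
            ≤ ∑ ρ' ∈ Zχ, (discDivisor χ₁ v ρ' : ℝ) :=
              Finset.sum_le_sum_of_subset_of_nonneg (Finset.filter_subset _ _) fun ρ' _ _ => by
                exact_mod_cast discDivisor_nonneg hχ₁ v ρ'
          _ ≤ C_J * (Real.log q₁ + Real.log (|v| + 4)) := hjensen q₁ χ₁ hχ₁ v
          _ ≤ C_J * L' := mul_le_mul_of_nonneg_left hLχ hC_J.le
          _ ≤ (2 * C_d + 8 * C_J) * (1 + lam * L') := by
              nlinarith [mul_nonneg hC_d.le hlamL, mul_nonneg hC_J.le hlamL]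
    rw [hsplit, h1, h2, h2']
    nlinarith
  -- (3) the Jensen count
  have htot : ∑ ρ ∈ Z, (D ρ : ℝ) ≤ (C_Jζ + C_J) * L' := by
    have hsplit : ∑ ρ ∈ Z, (D ρ : ℝ) = ∑ ρ ∈ Z, (D₁ ρ : ℝ) + ∑ ρ ∈ Z, (D₂ ρ : ℝ) := by
      rw [← Finset.sum_add_distrib]
      refine Finset.sum_congr rfl fun ρ _ => ?_
      simp only [hD]; push_cast; ring
    have h1 : ∑ ρ ∈ Z, (D₁ ρ : ℝ) = ∑ ρ ∈ Z₁, (D₁ ρ : ℝ) := by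
      symm
      apply Finset.sum_subset Finset.subset_union_left
      intro ρ _ hρ'; rw [hD₁0 ρ hρ']; simp
    have h2 : ∑ ρ ∈ Z, (D₂ ρ : ℝ) = ∑ ρ' ∈ Zχ, (discDivisor χ₁ v ρ' : ℝ) := by
      have : ∑ ρ ∈ Z, (D₂ ρ : ℝ) = ∑ ρ ∈ Z₂, (D₂ ρ : ℝ) := by
        symm
        apply Finset.sum_subset Finset.subset_union_right
        intro ρ _ hρ'; rw [hD₂0 ρ hρ']; simp
      rw [this, hZ₂, Finset.sum_image hinj]
      refine Finset.sum_congr rfl fun ρ' _ => ?_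
      simp only [hD₂, sub_add_cancel]
    rw [hsplit, h1, h2]
    have e1 : ∑ ρ ∈ Z₁, (D₁ ρ : ℝ) ≤ C_Jζ * L' :=
      (hjensenζ v).trans (mul_le_mul_of_nonneg_left hLv hC_Jζ.le)
    have e2 := (hjensen q₁ χ₁ hχ₁ v).trans (mul_le_mul_of_nonneg_left hLχ hC_J.le)
    linarith
  -- (4) the Cauchy estimates of the two factors add, and the pole term is bounded
  have hs₀mem : s₀ ∈ closedBall (2 + (v : ℂ) * I) (8 / 5) := by
    have := add_mem_closedBall_two_zeta (v := v) hr le_rfl (by linarith : r + 0 ≤ 1)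
    simpa [hs₀] using this
  have hs₁mem : s₀ + (δ₁ : ℂ) ∈ closedBall (2 + (v : ℂ) * I) (69 / 50) :=
    add_mem_closedBall_two hr hδ (by linarith)
  have hs₀re : s₀.re = 1 + r := by simp [hs₀]
  have hs₁re : 1 < (s₀ + (δ₁ : ℂ)).re := by simp [hs₀]; linarith
  have hs₀1 : s₀ ≠ 1 := by
    intro h; have := congr_arg Complex.re h; rw [hs₀re, one_re] at this; linarith
  have hL0 : riemannZeta₁ s₀ ≠ 0 := fun h =>
    riemannZeta_ne_zero_of_one_le_re (by rw [hs₀re]; linarith) ((riemannZeta₁_eq_zero_iff hs₀1).1 h)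
  have hL1 : χ₁.LFunction (s₀ + (δ₁ : ℂ)) ≠ 0 :=
    DirichletCharacter.LFunction_ne_zero_of_one_le_re χ₁ (Or.inl hχ₁) hs₁re.le
  have hpole : ∀ k : ℕ, ‖(-1 : ℂ) ^ k * k.factorial * (1 / (s₀ - 1) ^ (k + 1))‖ ≤
      k.factorial * 16 ^ k * 2 := by
    intro k
    refine norm_poleTerm_le ?_ k
    have him : (s₀ - 1).im = v := by simp [hs₀]
    calc (1 : ℝ) / 2 ≤ |v| := hv
      _ = |(s₀ - 1).im| := by rw [him]
      _ ≤ ‖s₀ - 1‖ := Complex.abs_im_le_norm _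
  have hcauchy : ∀ k : ℕ, ‖a k - (-1) ^ k * k.factorial *
      ∑ ρ ∈ Z, (D ρ : ℂ) / (s₀ - ρ) ^ (k + 1)‖ ≤ k.factorial * 16 ^ k * ((C₁ζ + C₁ + 2) * L') := by
    intro k
    have hsplit : ∑ ρ ∈ Z, (D ρ : ℂ) / (s₀ - ρ) ^ (k + 1) =
        ∑ ρ ∈ Z, (D₁ ρ : ℂ) / (s₀ - ρ) ^ (k + 1) + ∑ ρ ∈ Z, (D₂ ρ : ℂ) / (s₀ - ρ) ^ (k + 1) := by
      rw [← Finset.sum_add_distrib]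
      refine Finset.sum_congr rfl fun ρ _ => ?_
      simp only [hD]; push_cast; ring
    have h1 : ∑ ρ ∈ Z, (D₁ ρ : ℂ) / (s₀ - ρ) ^ (k + 1) =
        ∑ ρ ∈ Z₁, (zetaDiscDivisor v ρ : ℂ) / (s₀ - ρ) ^ (k + 1) := by
      symm
      apply Finset.sum_subset Finset.subset_union_left
      intro ρ _ hρ'
      have : D₁ ρ = 0 := hD₁0 ρ hρ'
      simp only [hD₁] at this; rw [this]; simp
    have h2 : ∑ ρ ∈ Z, (D₂ ρ : ℂ) / (s₀ - ρ) ^ (k + 1) =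
        ∑ ρ' ∈ Zχ, (discDivisor χ₁ v ρ' : ℂ) / ((s₀ + (δ₁ : ℂ)) - ρ') ^ (k + 1) := by
      have : ∑ ρ ∈ Z, (D₂ ρ : ℂ) / (s₀ - ρ) ^ (k + 1) =
          ∑ ρ ∈ Z₂, (D₂ ρ : ℂ) / (s₀ - ρ) ^ (k + 1) := by
        symm
        apply Finset.sum_subset Finset.subset_union_right
        intro ρ _ hρ'; rw [hD₂0 ρ hρ']; simp
      rw [this, hZ₂, Finset.sum_image hinj]
      refine Finset.sum_congr rfl fun ρ' _ => ?_
      simp only [hD₂, sub_add_cancel]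
      congr 1
      ring
    have e1 := hderivζ v s₀ hs₀mem hL0 k
    have e2 := hderiv q₁ χ₁ hχ₁ v (s₀ + (δ₁ : ℂ)) hs₁mem hL1 k
    have e3 := hpole k
    calc ‖a k - (-1) ^ k * k.factorial * ∑ ρ ∈ Z, (D ρ : ℂ) / (s₀ - ρ) ^ (k + 1)‖
        = ‖(iteratedDeriv k (logDeriv riemannZeta₁) s₀ -
              (-1) ^ k * k.factorial * ∑ ρ ∈ Z₁, (zetaDiscDivisor v ρ : ℂ) / (s₀ - ρ) ^ (k + 1)) +
            (iteratedDeriv k (logDeriv χ₁.LFunction) (s₀ + (δ₁ : ℂ)) -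
              (-1) ^ k * k.factorial *
                ∑ ρ' ∈ Zχ, (discDivisor χ₁ v ρ' : ℂ) / ((s₀ + (δ₁ : ℂ)) - ρ') ^ (k + 1)) +
            (-((-1 : ℂ) ^ k * k.factorial * (1 / (s₀ - 1) ^ (k + 1))))‖ := by
          rw [hsplit, h1, h2]; simp only [ha]; ring_nf
      _ ≤ ‖(iteratedDeriv k (logDeriv riemannZeta₁) s₀ -
              (-1) ^ k * k.factorial * ∑ ρ ∈ Z₁, (zetaDiscDivisor v ρ : ℂ) / (s₀ - ρ) ^ (k + 1)) +
            (iteratedDeriv k (logDeriv χ₁.LFunction) (s₀ + (δ₁ : ℂ)) -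
              (-1) ^ k * k.factorial *
                ∑ ρ' ∈ Zχ, (discDivisor χ₁ v ρ' : ℂ) / ((s₀ + (δ₁ : ℂ)) - ρ') ^ (k + 1))‖ +
            ‖-((-1 : ℂ) ^ k * k.factorial * (1 / (s₀ - 1) ^ (k + 1)))‖ := norm_add_le _ _
      _ ≤ (k.factorial * 16 ^ k * (C₁ζ * Real.log (|v| + 4)) +
            k.factorial * 16 ^ k * (C₁ * (Real.log q₁ + Real.log (|v| + 4)))) +
            k.factorial * 16 ^ k * 2 := by
          refine add_le_add ((norm_add_le _ _).trans (add_le_add e1 e2)) ?_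
          rw [norm_neg]; exact e3
      _ ≤ (k.factorial * 16 ^ k * (C₁ζ * L') + k.factorial * 16 ^ k * (C₁ * L')) +
            k.factorial * 16 ^ k * (2 * L') := by
          gcongr
          · have : (k.factorial : ℝ) * 16 ^ k * 2 * 1 ≤ k.factorial * 16 ^ k * 2 * L' :=
              mul_le_mul_of_nonneg_left hL'1 (by positivity)
            linarith
      _ = k.factorial * 16 ^ k * ((C₁ζ + C₁ + 2) * L') := by ring
  -- (5) the given zero lies in `Z`
  have hzero' : ∃ ρ₀ ∈ Z, ‖ρ₀ - (1 + (v : ℂ) * I)‖ ≤ r := by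
    obtain ⟨ρ₀, h0, h0r⟩ := hzero
    exact ⟨ρ₀, Finset.mem_union_left _ h0, h0r⟩
  have hDnn' : ∀ ρ, (0 : ℤ) ≤ D ρ := hDnn
  exact hA Z D a v r L' hr hr8 hu hDnn' hZprop hloc htot hcauchy hzero' K hK

/-- **Lemme B in the Deuring–Heilbronn case, configuration (D3)** (the term `q = 1`): for
`χ₁` real (`χ₁² = χ₀`, `χ₁ ≠ χ₀`) mod `q₁`, `0 ≤ δ₁`, `log q₁ + log(|v| + 4) ≤ L'`, `δ₁ L' ≤ 1`,
`|v| ≥ 1/2`, `0 < r ≤ r₀`, `rL' ≥ 1`, a zero `ρ₀` of `ζ` with `|ρ₀ − (1 + iv)| ≤ r`, `log x ≥ A₀ L'`,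
`z ≤ x^{a₀/2}`:
`(e^{−10}/4) x^{−r/10}/r³ ≤ ∫_{⌊x^{a₀}⌋}^{x} ‖∑_{sifted n ≤ t} w(n) n^{−1−iv}‖² dt/t`,
`w = Λ(1 + χ₁ n^{−δ₁})/2` with the trivial character mod `1`. [cite: Bombieri1987GrandCrible, §6 Lemme B] -/
theorem lemmeB_D3 :
    ∃ A₀ r₀ : ℝ, 0 < A₀ ∧ 0 < r₀ ∧
      ∀ (q₁ : ℕ) [NeZero q₁] (χ₁ : DirichletCharacter ℂ q₁), χ₁ ^ 2 = 1 → χ₁ ≠ 1 →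
      ∀ (δ₁ v r L' x : ℝ) (z : ℕ), 0 ≤ δ₁ →
        Real.log q₁ + Real.log (|v| + 4) ≤ L' → δ₁ * L' ≤ 1 → 1 / 2 ≤ |v| →
        0 < r → r ≤ r₀ → 1 ≤ r * L' →
        (∃ ρ₀ ∈ zetaDiscZeros v, ‖ρ₀ - (1 + (v : ℂ) * I)‖ ≤ r) → 0 < x → A₀ * L' ≤ Real.log x →
        (z : ℝ) ≤ x ^ (expoB / 2) →
          Real.exp (-10) / 4 * x ^ (-(r / 10)) / r ^ 3 ≤
            ∫ t in Set.Ioc (⌊x ^ expoB⌋₊ : ℝ) x,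
              ‖summatory (coefSiftedW (dhW χ₁ δ₁) (1 : DirichletCharacter ℂ 1) v x z) t‖ ^ 2 / t := by
  obtain ⟨c₄, hc₄, hA⟩ := lemmeA_D3
  refine ⟨240 * (c₄ + 8 * Real.exp 14 + 8), min (1 / (112 * Real.exp 14)) (1 / 4096),
    by positivity, by positivity,
    fun q₁ _ χ₁ hχ₁sq hχ₁ δ₁ v r L' x z hδ hL hδL hv hr hr0 hu hzero hx hlogx hz => ?_⟩
  have hw : ∀ n, |dhW χ₁ δ₁ n| ≤ Λ n := fun n => abs_dhW_le χ₁ hδ n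
  have hr1 : r ≤ 1 / (112 * Real.exp 14) := hr0.trans (min_le_left _ _)
  have hr2 : r ≤ 1 / 4096 := hr0.trans (min_le_right _ _)
  have hr8 : 512 * r ≤ 1 / 8 := by linarith
  have h := lemmeB_generic hw (1 : DirichletCharacter ℂ 1) v (c₄ := c₄) (η := 2) (r := r)
    (L' := L') (x := x) (z := z) hc₄ (by norm_num) (by norm_num) hr hr1 hu hx hlogx hz ?_
  · calc Real.exp (-10) / 4 * x ^ (-(r / 10)) / r ^ 3
        = Real.exp (-10) / 2 ^ 2 * x ^ (-(r / 10)) / r ^ 3 := by norm_num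
      _ ≤ _ := h
  · intro K hK
    obtain ⟨k, hk, hb⟩ := hA q₁ χ₁ hχ₁ δ₁ v r L' hδ hL hδL hv hr hr8 hu hzero K hK
    refine ⟨k, hk, ?_⟩
    have hD3 := iteratedDeriv_add_D3 χ₁ hχ₁sq hδ v hr k
    rw [← sub_eq_iff_eq_add] at hD3
    rw [hD3] at hb
    exact hAout_of_mainTerm hr _ hb

/-- **The zero side of Théorème 14 (second assertion) for `ζ`, configuration (D3)** (as the
tree's `zeroSideZeta`, with the Deuring–Heilbronn weights; the zeros are taken at heights
`|γ| ≥ 3 + r/2`, where the pole of `ζ` does not interfere): there are absolute `A₀, r₀, C > 0`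
such that for `χ₁` real, `χ₁ ≠ χ₀`, mod `q₁`, `0 ≤ δ₁`, `log q₁ + log(T' + 4) ≤ L'`, `δ₁ L' ≤ 1`,
`0 < r ≤ r₀`, `rL' ≥ 1`, `1 ≤ x`, `log x ≥ A₀ L'`, `z ≤ x^{a₀/2}`, and any finite set `Z` of zeros of
`ζ` with `1 − r/2 ≤ β < 1`, `3 + r/2 ≤ |γ|`, `|γ| + r/2 ≤ T'`:
`r · (e^{−10}/4) x^{−r/10} r^{−3} · ∑_{ρ ∈ Z} m(ρ) ≤ C (rL') ∫_{−T'}^{T'} I_{w,χ₀}(v) dv`.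
[cite: Bombieri1987GrandCrible, §6 Théorème 14 (proof)] -/
theorem zeroSide_D3 :
    ∃ A₀ r₀ C : ℝ, 0 < A₀ ∧ 0 < r₀ ∧ 0 < C ∧
      ∀ (q₁ : ℕ) [NeZero q₁] (χ₁ : DirichletCharacter ℂ q₁), χ₁ ^ 2 = 1 → χ₁ ≠ 1 →
      ∀ (δ₁ T' r L' x : ℝ) (z : ℕ) (Zρ : Finset ℂ), 0 ≤ δ₁ →
        Real.log q₁ + Real.log (T' + 4) ≤ L' → δ₁ * L' ≤ 1 →
        0 < r → r ≤ r₀ → 1 ≤ r * L' → 1 ≤ x →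
        A₀ * L' ≤ Real.log x → (z : ℝ) ≤ x ^ (expoB / 2) → 0 ≤ T' →
        (∀ ρ ∈ Zρ, riemannZeta ρ = 0 ∧ 1 - r / 2 ≤ ρ.re ∧ ρ.re < 1 ∧ 3 + r / 2 ≤ |ρ.im| ∧
          |ρ.im| + r / 2 ≤ T') →
          r * (Real.exp (-10) / 4 * x ^ (-(r / 10)) / r ^ 3) *
              ∑ ρ ∈ Zρ, ((riemannZetaZeroOrder ρ : ℤ) : ℝ) ≤
            C * (r * L') * ∫ v in (-T')..T', meanValueW (dhW χ₁ δ₁) (1 : DirichletCharacter ℂ 1) x z v := by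
  obtain ⟨A₀, r₀, hA₀, hr₀, hB⟩ := lemmeB_D3
  obtain ⟨C_d, hC_d, hdens⟩ := exists_sum_near_le_zeta
  refine ⟨A₀, min r₀ (1 / 4), 2 * C_d, hA₀, by positivity, by positivity,
    fun q₁ _ χ₁ hχ₁sq hχ₁ δ₁ T' r L' x z Zρ hδ hLL' hδL hr hrmin hu hx hlogx hz hT' hZ => ?_⟩
  classical
  have hw : ∀ n, |dhW χ₁ δ₁ n| ≤ Λ n := fun n => abs_dhW_le χ₁ hδ n
  have hr0 : r ≤ r₀ := hrmin.trans (min_le_left _ _)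
  have hr4 : r ≤ 1 / 4 := hrmin.trans (min_le_right _ _)
  have hlogq0 : 0 ≤ Real.log q₁ := Real.log_natCast_nonneg _
  set L₀ : ℝ := Real.exp (-10) / 4 * x ^ (-(r / 10)) / r ^ 3 with hL₀
  set A : Set ℝ := Set.Icc (-T') T' with hA
  have hxpos : 0 < x := by linarith
  have hNX : 1 ≤ ⌊x ^ expoB⌋₊ := Nat.le_floor (by
    simp only [Nat.cast_one]; exact Real.one_le_rpow hx expoB_pos.le)
  have hint : IntegrableOn (meanValueW (dhW χ₁ δ₁) (1 : DirichletCharacter ℂ 1) x z) A :=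
    integrableOn_meanValueW hw _ hx z hNX _ _
  -- Lemme B at every `v` within `r/2` of the height of a zero of `Z`
  have hLB : ∀ ρ ∈ Zρ, ∀ v ∈ Set.Icc (ρ.im - r / 2) (ρ.im + r / 2),
      L₀ ≤ meanValueW (dhW χ₁ δ₁) (1 : DirichletCharacter ℂ 1) x z v := by
    intro ρ hρ v hv
    obtain ⟨h0, hβ, hβ1, hγ3, hγT⟩ := hZ ρ hρ
    rw [Set.mem_Icc] at hv
    have hvT : |v| ≤ T' := by
      have h1 : |ρ.im| ≤ T' - r / 2 := by linarith
      have h2 := abs_le.1 h1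
      rw [abs_le]; constructor <;> linarith
    have hv3 : 3 ≤ |v| := by
      rcases le_or_gt 0 ρ.im with hpos | hneg
      · rw [abs_of_nonneg hpos] at hγ3
        have : 3 ≤ v := by linarith
        rw [abs_of_nonneg (by linarith)]; exact this
      · rw [abs_of_neg hneg] at hγ3
        have : v ≤ -3 := by linarith
        rw [abs_of_neg (by linarith)]; linarith
    have hLL'v : Real.log q₁ + Real.log (|v| + 4) ≤ L' := by
      have := Real.log_le_log (by positivity) (show |v| + 4 ≤ T' + 4 by linarith)
      linarith
    have hγ : |ρ.im - v| ≤ r / 2 := by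
      rw [abs_le]; constructor <;> linarith
    have hnorm : ‖ρ - (1 + (v : ℂ) * I)‖ ≤ r := by
      have hre : (ρ - (1 + (v : ℂ) * I)).re = ρ.re - 1 := by simp
      have him : (ρ - (1 + (v : ℂ) * I)).im = ρ.im - v := by simp
      calc ‖ρ - (1 + (v : ℂ) * I)‖ ≤ |(ρ - (1 + (v : ℂ) * I)).re| + |(ρ - (1 + (v : ℂ) * I)).im| :=
            Complex.norm_le_abs_re_add_abs_im _
        _ ≤ r / 2 + r / 2 := by
            rw [hre, him]
            refine add_le_add ?_ hγ
            rw [abs_sub_comm, abs_of_nonneg (by linarith)]; linarith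
        _ = r := by ring
    have hρ1 : ρ ≠ 1 := by
      intro h; rw [h, one_re] at hβ1; exact lt_irrefl _ hβ1
    have hdisc : ρ ∈ zetaDiscZeros v := by
      refine mem_zetaDiscZeros.2 ⟨?_, ?_⟩
      · rw [Metric.mem_closedBall, dist_eq_norm]
        calc ‖ρ - (2 + (v : ℂ) * I)‖ = ‖(ρ - (1 + (v : ℂ) * I)) - 1‖ := by ring_nf
          _ ≤ ‖ρ - (1 + (v : ℂ) * I)‖ + ‖(1 : ℂ)‖ := norm_sub_le _ _
          _ ≤ r + 1 := by rw [norm_one]; linarith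
          _ ≤ 37 / 20 := by linarith
      · rw [riemannZeta₁_eq_zero_iff hρ1]; exact h0
    exact hB q₁ χ₁ hχ₁sq hχ₁ δ₁ v r L' x z hδ hLL'v hδL (by linarith) hr hr0 hu ⟨ρ, hdisc, hnorm⟩
      hxpos hlogx hz
  -- per zero: `r L₀ ≤ ∫_A 𝟙_{J_ρ} I`
  have hper : ∀ ρ ∈ Zρ, r * L₀ ≤
      ∫ v in A, (Set.Icc (ρ.im - r / 2) (ρ.im + r / 2)).indicator
        (meanValueW (dhW χ₁ δ₁) (1 : DirichletCharacter ℂ 1) x z) v := by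
    intro ρ hρ
    obtain ⟨-, -, -, -, hγT⟩ := hZ ρ hρ
    set J : Set ℝ := Set.Icc (ρ.im - r / 2) (ρ.im + r / 2) with hJ
    have hJA : J ⊆ A := by
      intro v hv
      rw [hJ, Set.mem_Icc] at hv
      rw [hA, Set.mem_Icc]
      have h1 : |ρ.im| ≤ T' - r / 2 := by linarith
      have h2 := abs_le.1 h1
      constructor <;> linarith
    rw [setIntegral_indicator measurableSet_Icc, Set.inter_eq_right.2 hJA]
    have hvol : volume.real J = r := by
      rw [hJ, Measure.real, Real.volume_Icc, ENNReal.toReal_ofReal (by linarith)]; ring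
    have h := setIntegral_ge_of_const_le_real (c := L₀) measurableSet_Icc measure_Icc_lt_top.ne
      (fun v hv => hLB ρ hρ v hv) (hint.mono_set hJA)
    rw [hvol] at h
    linarith
  -- sum over the zeros and bound the overlap
  have hsum : r * L₀ * ∑ ρ ∈ Zρ, ((riemannZetaZeroOrder ρ : ℤ) : ℝ) ≤
      ∫ v in A, ∑ ρ ∈ Zρ, ((riemannZetaZeroOrder ρ : ℤ) : ℝ) *
        (Set.Icc (ρ.im - r / 2) (ρ.im + r / 2)).indicator
          (meanValueW (dhW χ₁ δ₁) (1 : DirichletCharacter ℂ 1) x z) v := by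
    rw [mul_sum, integral_finsetSum _ fun ρ _ => (hint.indicator measurableSet_Icc).const_mul _]
    refine sum_le_sum fun ρ hρ => ?_
    rw [integral_const_mul]
    have hρ1 : ρ ≠ 1 := by
      intro h; have := (hZ ρ hρ).2.2.1; rw [h, one_re] at this; exact lt_irrefl _ this
    have h0 : (0 : ℝ) ≤ ((riemannZetaZeroOrder ρ : ℤ) : ℝ) := by
      exact_mod_cast riemannZetaZeroOrder_nonneg hρ1
    calc r * L₀ * ((riemannZetaZeroOrder ρ : ℤ) : ℝ) = ((riemannZetaZeroOrder ρ : ℤ) : ℝ) * (r * L₀) := by ring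
      _ ≤ _ := mul_le_mul_of_nonneg_left (hper ρ hρ) h0
  refine hsum.trans ?_
  have hℒ : ∀ v ∈ A, Real.log (|v| + 4) ≤ L' := by
    intro v hv
    rw [hA, Set.mem_Icc] at hv
    have hvT : |v| ≤ T' := abs_le.2 ⟨hv.1, hv.2⟩
    have := Real.log_le_log (by positivity) (show |v| + 4 ≤ T' + 4 by linarith)
    linarith
  have hpt : ∀ v ∈ A, ∑ ρ ∈ Zρ, ((riemannZetaZeroOrder ρ : ℤ) : ℝ) *
      (Set.Icc (ρ.im - r / 2) (ρ.im + r / 2)).indicator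
        (meanValueW (dhW χ₁ δ₁) (1 : DirichletCharacter ℂ 1) x z) v ≤
        (2 * C_d * (r * L')) * meanValueW (dhW χ₁ δ₁) (1 : DirichletCharacter ℂ 1) x z v := by
    intro v hv
    have heq : ∑ ρ ∈ Zρ, ((riemannZetaZeroOrder ρ : ℤ) : ℝ) *
        (Set.Icc (ρ.im - r / 2) (ρ.im + r / 2)).indicator
          (meanValueW (dhW χ₁ δ₁) (1 : DirichletCharacter ℂ 1) x z) v =
        (∑ ρ ∈ Zρ.filter (fun ρ => |ρ.im - v| ≤ r / 2), ((riemannZetaZeroOrder ρ : ℤ) : ℝ)) *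
          meanValueW (dhW χ₁ δ₁) (1 : DirichletCharacter ℂ 1) x z v := by
      rw [sum_mul, sum_filter]
      refine sum_congr rfl fun ρ _ => ?_
      by_cases h : |ρ.im - v| ≤ r / 2
      · rw [if_pos h, Set.indicator_of_mem]
        rw [Set.mem_Icc]; rw [abs_le] at h; constructor <;> linarith
      · rw [if_neg h, Set.indicator_of_notMem, mul_zero]
        rw [Set.mem_Icc]; intro h'; exact h (abs_le.2 ⟨by linarith, by linarith⟩)
    rw [heq]
    refine mul_le_mul_of_nonneg_right ?_ (meanValueW_nonneg _ _ x z v)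
    have h1 := overlap_le_zeta hdens hr hr4 Zρ
      (fun ρ hρ => ⟨(hZ ρ hρ).1, (hZ ρ hρ).2.1, (hZ ρ hρ).2.2.1⟩) v
    have h2 : C_d * (1 + r * Real.log (|v| + 4)) ≤ 2 * C_d * (r * L') := by
      have := hℒ v hv
      have h3 : r * Real.log (|v| + 4) ≤ r * L' := mul_le_mul_of_nonneg_left this hr.le
      nlinarith [hC_d, hu]
    exact h1.trans h2
  have hi1 : IntegrableOn (fun v => ∑ ρ ∈ Zρ, ((riemannZetaZeroOrder ρ : ℤ) : ℝ) *
      (Set.Icc (ρ.im - r / 2) (ρ.im + r / 2)).indicator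
        (meanValueW (dhW χ₁ δ₁) (1 : DirichletCharacter ℂ 1) x z) v) A :=
    integrable_finsetSum _ fun ρ _ => (hint.indicator measurableSet_Icc).const_mul _
  calc ∫ v in A, ∑ ρ ∈ Zρ, ((riemannZetaZeroOrder ρ : ℤ) : ℝ) *
        (Set.Icc (ρ.im - r / 2) (ρ.im + r / 2)).indicator
          (meanValueW (dhW χ₁ δ₁) (1 : DirichletCharacter ℂ 1) x z) v
      ≤ ∫ v in A, (2 * C_d * (r * L')) * meanValueW (dhW χ₁ δ₁) (1 : DirichletCharacter ℂ 1) x z v :=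
        setIntegral_mono_on hi1 (hint.const_mul _) measurableSet_Icc hpt
    _ = (2 * C_d * (r * L')) *
        ∫ v in (-T')..T', meanValueW (dhW χ₁ δ₁) (1 : DirichletCharacter ℂ 1) x z v := by
        rw [integral_const_mul, hA, integral_Icc_eq_integral_Ioc,
          ← intervalIntegral.integral_of_le (by linarith)]

/-! ### (D2) Lemme A for `F = L'/L(s, χ₁) + ζ₁'/ζ₁(s + δ₁) − 1/(s − β₁)` -/

set_option maxHeartbeats 1600000 in
/-- **Lemme A in the Deuring–Heilbronn case, configuration (D2)** (Bombieri, *Le grand crible*, §6,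
p. 43, the exceptional character itself): there is an absolute `c₄ > 0` such that for `χ₁ ≠ χ₀`
mod `q₁` with the SIMPLE real zero `β₁ = 1 − δ₁` (`m(β₁) ≤ 1`), `0 ≤ δ₁`,
`log q₁ + log(|v|+4) ≤ L'`, `δ₁ L' ≤ 1`, `0 < r`, `512 r ≤ 1/8`, `rL' ≥ 1`, if `L(s, χ₁)` has a
zero `ρ₀ ≠ β₁` with `|ρ₀ − (1 + iv)| ≤ r`, then for every `K ≥ c₄ rL' + 2` there is `k ∈ [K, 2K]`
with `e^{−10K}(2r)^{−(k+1)} ≤ (1/k!)‖(L'/L)^{(k)}(s₀, χ₁) + (ζ₁'/ζ₁)^{(k)}(s₀ + δ₁) − (−1)^k k!/(s₀ + δ₁ − 1)^{k+1}‖`,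
`s₀ = 1 + r + iv` (the subtracted term is the common polar part of the zero `β₁` and of the pole
of `ζ(s + δ₁)`). [cite: Bombieri1987GrandCrible, §6 Lemme A] -/
theorem lemmeA_D2 :
    ∃ c₄ : ℝ, 0 < c₄ ∧
      ∀ (q₁ : ℕ) [NeZero q₁] (χ₁ : DirichletCharacter ℂ q₁), χ₁ ≠ 1 →
      ∀ (δ₁ v r L' : ℝ), 0 ≤ δ₁ → χ₁.LFunction ((1 - δ₁ : ℝ) : ℂ) = 0 →
        zeroOrder χ₁ ((1 - δ₁ : ℝ) : ℂ) ≤ 1 →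
        Real.log q₁ + Real.log (|v| + 4) ≤ L' → δ₁ * L' ≤ 1 →
        0 < r → 512 * r ≤ 1 / 8 → 1 ≤ r * L' →
        (∃ ρ₀ ∈ discZeros χ₁ v, ρ₀ ≠ ((1 - δ₁ : ℝ) : ℂ) ∧ ‖ρ₀ - (1 + (v : ℂ) * I)‖ ≤ r) →
        ∀ K : ℕ, c₄ * (r * L') + 2 ≤ K →
          ∃ k ∈ Finset.Icc K (2 * K),
            Real.exp (-(10 * K)) * (2 * r)⁻¹ ^ (k + 1) ≤
              ‖iteratedDeriv k (logDeriv χ₁.LFunction) (((1 + r : ℝ) : ℂ) + (v : ℂ) * I) +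
                iteratedDeriv k (logDeriv riemannZeta₁) (((1 + r : ℝ) : ℂ) + (v : ℂ) * I + δ₁) -
                (-1) ^ k * k.factorial *
                  (1 / (((1 + r : ℝ) : ℂ) + (v : ℂ) * I + δ₁ - 1) ^ (k + 1))‖ / k.factorial := by
  obtain ⟨C_d, hC_d, hdens⟩ := exists_sum_near_le
  obtain ⟨C_J, hC_J, hjensen⟩ := exists_sum_discZeros_le
  obtain ⟨C₁, hC₁, hderiv⟩ := exists_norm_iteratedDeriv_logDeriv_sub_le
  obtain ⟨C_dζ, hC_dζ, hdensζ⟩ := exists_sum_near_le_zeta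
  obtain ⟨C_Jζ, hC_Jζ, hjensenζ⟩ := exists_sum_zetaDiscZeros_le
  obtain ⟨C₁ζ, hC₁ζ, hderivζ⟩ := exists_norm_iteratedDeriv_logDeriv_sub_le_zeta
  obtain ⟨c₄, hc₄, hA⟩ := lemmeA_abstract (C_d := C_d + 2 * C_dζ + 8 * C_Jζ) (C_J := C_J + C_Jζ)
    (C₁ := C₁ + C₁ζ + 2) (by positivity) (by positivity) (by positivity)
  refine ⟨c₄, hc₄, fun q₁ _ χ₁ hχ₁ δ₁ v r L' hδ hβzero hβsimple hLχ hδL hr hr8 hu hzero K hK => ?_⟩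
  classical
  set β₁ : ℂ := ((1 - δ₁ : ℝ) : ℂ) with hβ₁
  set w : ℂ := 1 + (v : ℂ) * I with hw
  set s₀ : ℂ := ((1 + r : ℝ) : ℂ) + (v : ℂ) * I with hs₀
  set Zχ := discZeros χ₁ v with hZχ
  set Z₁ := Zχ.erase β₁ with hZ₁
  set Zζ := zetaDiscZeros v with hZζ
  set Z₂ := Zζ.image (fun ρ' : ℂ => ρ' - (δ₁ : ℂ)) with hZ₂
  set Z := Z₁ ∪ Z₂ with hZ
  set D₁ : ℂ → ℤ := fun ρ => if ρ = β₁ then 0 else discDivisor χ₁ v ρ with hD₁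
  set D₂ : ℂ → ℤ := fun ρ => zetaDiscDivisor v (ρ + (δ₁ : ℂ)) with hD₂
  set D : ℂ → ℤ := fun ρ => D₁ ρ + D₂ ρ with hD
  set a : ℕ → ℂ := fun k => iteratedDeriv k (logDeriv χ₁.LFunction) s₀ +
    iteratedDeriv k (logDeriv riemannZeta₁) (s₀ + δ₁) -
    (-1) ^ k * k.factorial * (1 / (s₀ + δ₁ - 1) ^ (k + 1)) with ha
  -- basic sizes
  have hℒv1 : 1 ≤ Real.log (|v| + 4) := ClassicalZFRData.one_le_log_tau v
  have hlogq0 : 0 ≤ Real.log q₁ := Real.log_natCast_nonneg _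
  have hLv : Real.log (|v| + 4) ≤ L' := by linarith
  have hL'1 : 1 ≤ L' := hℒv1.trans hLv
  have hr0 : r ≤ 1 / 4096 := by linarith
  have hL'big : 4096 ≤ L' := by
    by_contra h
    push Not at h
    nlinarith [mul_lt_mul_of_pos_left h hr]
  have hδsmall : δ₁ ≤ 1 / 4096 := by
    have h1 : δ₁ * 4096 ≤ δ₁ * L' := mul_le_mul_of_nonneg_left hL'big hδ
    nlinarith
  have hs₀δ : s₀ + (δ₁ : ℂ) - 1 = s₀ - β₁ := by rw [hβ₁]; push_cast; ring
  -- vanishing of the weights off their supports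
  have hD₁0 : ∀ ρ, ρ ∉ Z₁ → D₁ ρ = 0 := by
    intro ρ h
    simp only [hD₁]
    split_ifs with hb
    · rfl
    · apply discDivisor_eq_zero_of_notMem χ₁ v
      intro hmem; exact h (Finset.mem_erase.2 ⟨hb, hmem⟩)
  have hD₂0 : ∀ ρ, ρ ∉ Z₂ → D₂ ρ = 0 := by
    intro ρ h
    apply zetaDiscDivisor_eq_zero_of_notMem v
    intro hmem
    apply h
    rw [hZ₂, Finset.mem_image]
    exact ⟨ρ + δ₁, hmem, by ring⟩
  have hD₁nn : ∀ ρ, 0 ≤ D₁ ρ := by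
    intro ρ; simp only [hD₁]; split_ifs
    · exact le_rfl
    · exact discDivisor_nonneg hχ₁ v ρ
  have hD₁le : ∀ ρ, D₁ ρ ≤ discDivisor χ₁ v ρ := by
    intro ρ; simp only [hD₁]; split_ifs
    · exact discDivisor_nonneg hχ₁ v ρ
    · exact le_rfl
  have hD₂nn : ∀ ρ, 0 ≤ D₂ ρ := fun ρ => zetaDiscDivisor_nonneg v _
  have hDnn : ∀ ρ, 0 ≤ D ρ := fun ρ => add_nonneg (hD₁nn ρ) (hD₂nn ρ)
  have hinj : Set.InjOn (fun ρ' : ℂ => ρ' - (δ₁ : ℂ)) (Zζ : Set ℂ) :=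
    fun a _ b _ h => by simpa using h
  have hZ₁sub : Z₁ ⊆ Zχ := Finset.erase_subset _ _
  -- (1) the points of `Z` have `Re < 1` and weight `≥ 1`
  have hZprop : ∀ ρ ∈ Z, ρ.re < 1 ∧ (1 : ℝ) ≤ D ρ := by
    intro ρ hρ
    rw [hZ, Finset.mem_union] at hρ
    rcases hρ with h1 | h2
    · obtain ⟨hne, h1'⟩ := Finset.mem_erase.1 h1
      obtain ⟨-, -, -, hre, hdiv, hm⟩ := discZeros_prop hχ₁ h1'
      refine ⟨hre, ?_⟩
      have : (1 : ℤ) ≤ D₁ ρ := by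
        simp only [hD₁, if_neg hne]; rw [hdiv]; exact_mod_cast hm
      have h2 := hD₂nn ρ
      simp only [hD]; push_cast; exact_mod_cast (by omega : (1:ℤ) ≤ D₁ ρ + D₂ ρ)
    · rw [hZ₂, Finset.mem_image] at h2
      obtain ⟨ρ', hρ', rfl⟩ := h2
      obtain ⟨-, -, -, -, hdiv, hm⟩ := zetaDiscZeros_prop hρ'
      have hre := zeta_re_lt_one_of_mem hρ'
      refine ⟨by simp; linarith, ?_⟩
      have : (1 : ℤ) ≤ D₂ (ρ' - δ₁) := by
        rw [hD₂]; dsimp only; rw [sub_add_cancel, hdiv]; exact_mod_cast hm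
      have h1 := hD₁nn (ρ' - δ₁)
      simp only [hD]; push_cast; exact_mod_cast (by omega : (1:ℤ) ≤ D₁ (ρ' - δ₁) + D₂ (ρ' - δ₁))
  -- (2) the local count
  have hloc : ∀ lam : ℝ, 0 < lam → lam ≤ 1 / 4 →
      ∑ ρ ∈ Z.filter (fun ρ => ‖ρ - (1 + (v : ℂ) * I)‖ ≤ lam), (D ρ : ℝ) ≤
        (C_d + 2 * C_dζ + 8 * C_Jζ) * (1 + lam * L') := by
    intro lam hlam hlam4
    set P : ℂ → Prop := fun ρ => ‖ρ - (1 + (v : ℂ) * I)‖ ≤ lam with hP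
    have hsplit : ∑ ρ ∈ Z.filter P, (D ρ : ℝ) =
        ∑ ρ ∈ Z.filter P, (D₁ ρ : ℝ) + ∑ ρ ∈ Z.filter P, (D₂ ρ : ℝ) := by
      rw [← Finset.sum_add_distrib]
      refine Finset.sum_congr rfl fun ρ _ => ?_
      simp only [hD]; push_cast; ring
    have h1 : ∑ ρ ∈ Z.filter P, (D₁ ρ : ℝ) = ∑ ρ ∈ Z₁.filter P, (D₁ ρ : ℝ) := by
      symm
      apply Finset.sum_subset
      · exact Finset.filter_subset_filter _ (Finset.subset_union_left)
      · intro ρ hρ hρ'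
        have : ρ ∉ Z₁ := fun h => hρ' (Finset.mem_filter.2 ⟨h, (Finset.mem_filter.1 hρ).2⟩)
        rw [hD₁0 ρ this]; simp
    have h1b : ∑ ρ ∈ Z₁.filter P, (D₁ ρ : ℝ) ≤ C_d * (1 + lam * L') := by
      calc ∑ ρ ∈ Z₁.filter P, (D₁ ρ : ℝ) ≤ ∑ ρ ∈ Zχ.filter P, (discDivisor χ₁ v ρ : ℝ) := by
            refine (Finset.sum_le_sum_of_subset_of_nonneg (Finset.filter_subset_filter _ hZ₁sub)
              fun ρ _ _ => by exact_mod_cast hD₁nn ρ).trans ?_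
            exact Finset.sum_le_sum fun ρ _ => by exact_mod_cast hD₁le ρ
        _ ≤ C_d * (1 + lam * (Real.log q₁ + Real.log (|v| + 4))) := hdens q₁ χ₁ hχ₁ v lam hlam hlam4
        _ ≤ C_d * (1 + lam * L') := by
            have : lam * (Real.log q₁ + Real.log (|v| + 4)) ≤ lam * L' :=
              mul_le_mul_of_nonneg_left hLχ hlam.le
            nlinarith
    have h2 : ∑ ρ ∈ Z.filter P, (D₂ ρ : ℝ) = ∑ ρ ∈ Z₂.filter P, (D₂ ρ : ℝ) := by
      symm
      apply Finset.sum_subset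
      · exact Finset.filter_subset_filter _ (Finset.subset_union_right)
      · intro ρ hρ hρ'
        have : ρ ∉ Z₂ := fun h => hρ' (Finset.mem_filter.2 ⟨h, (Finset.mem_filter.1 hρ).2⟩)
        rw [hD₂0 ρ this]; simp
    have h2' : ∑ ρ ∈ Z₂.filter P, (D₂ ρ : ℝ) =
        ∑ ρ' ∈ Zζ.filter (fun ρ' => P (ρ' - δ₁)), (zetaDiscDivisor v ρ' : ℝ) := by
      rw [hZ₂, Finset.filter_image, Finset.sum_image (hinj.mono (by
        intro x hx; exact (Finset.mem_filter.1 hx).1))]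
      refine Finset.sum_congr rfl fun ρ' _ => ?_
      simp only [hD₂, sub_add_cancel]
    have h2b : ∑ ρ' ∈ Zζ.filter (fun ρ' => P (ρ' - δ₁)), (zetaDiscDivisor v ρ' : ℝ) ≤
        (2 * C_dζ + 8 * C_Jζ) * (1 + lam * L') := by
      by_cases hcase : lam + δ₁ ≤ 1 / 4
      · have hsub : Zζ.filter (fun ρ' => P (ρ' - δ₁)) ⊆
            Zζ.filter (fun ρ' => ‖ρ' - (1 + (v : ℂ) * I)‖ ≤ lam + δ₁) := by
          intro ρ' hρ'
          rw [Finset.mem_filter] at hρ' ⊢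
          refine ⟨hρ'.1, ?_⟩
          have hP' : ‖ρ' - (δ₁ : ℂ) - (1 + (v : ℂ) * I)‖ ≤ lam := hρ'.2
          calc ‖ρ' - (1 + (v : ℂ) * I)‖ = ‖(ρ' - (δ₁ : ℂ) - (1 + (v : ℂ) * I)) + (δ₁ : ℂ)‖ := by ring_nf
            _ ≤ ‖ρ' - (δ₁ : ℂ) - (1 + (v : ℂ) * I)‖ + ‖(δ₁ : ℂ)‖ := norm_add_le _ _
            _ ≤ lam + δ₁ := by
                rw [Complex.norm_real, Real.norm_eq_abs, abs_of_nonneg hδ]; linarith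
        calc ∑ ρ' ∈ Zζ.filter (fun ρ' => P (ρ' - δ₁)), (zetaDiscDivisor v ρ' : ℝ)
            ≤ ∑ ρ' ∈ Zζ.filter (fun ρ' => ‖ρ' - (1 + (v : ℂ) * I)‖ ≤ lam + δ₁),
                (zetaDiscDivisor v ρ' : ℝ) :=
              Finset.sum_le_sum_of_subset_of_nonneg hsub fun ρ' _ _ => by
                exact_mod_cast zetaDiscDivisor_nonneg v ρ'
          _ ≤ C_dζ * (1 + (lam + δ₁) * Real.log (|v| + 4)) := hdensζ v (lam + δ₁) (by linarith) hcase
          _ ≤ C_dζ * (1 + (lam + δ₁) * L') := by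
              have : (lam + δ₁) * Real.log (|v| + 4) ≤ (lam + δ₁) * L' :=
                mul_le_mul_of_nonneg_left hLv (by linarith)
              nlinarith
          _ ≤ C_dζ * (2 + lam * L') := by nlinarith
          _ ≤ (2 * C_dζ + 8 * C_Jζ) * (1 + lam * L') := by
              have hlamL : 0 ≤ lam * L' := by positivity
              nlinarith [mul_nonneg hC_dζ.le hlamL, mul_nonneg hC_Jζ.le hlamL]
      · push Not at hcase
        have hlam8 : 1 / 8 ≤ lam := by linarith
        have hCL : 0 ≤ C_Jζ * L' := by positivity
        have h8 : C_Jζ * L' ≤ C_Jζ * L' * (8 * lam) := le_mul_of_one_le_right hCL (by linarith)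
        have hlamL : 0 ≤ lam * L' := by positivity
        calc ∑ ρ' ∈ Zζ.filter (fun ρ' => P (ρ' - δ₁)), (zetaDiscDivisor v ρ' : ℝ)
            ≤ ∑ ρ' ∈ Zζ, (zetaDiscDivisor v ρ' : ℝ) :=
              Finset.sum_le_sum_of_subset_of_nonneg (Finset.filter_subset _ _) fun ρ' _ _ => by
                exact_mod_cast zetaDiscDivisor_nonneg v ρ'
          _ ≤ C_Jζ * Real.log (|v| + 4) := hjensenζ v
          _ ≤ C_Jζ * L' := mul_le_mul_of_nonneg_left hLv hC_Jζ.le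
          _ ≤ (2 * C_dζ + 8 * C_Jζ) * (1 + lam * L') := by
              nlinarith [mul_nonneg hC_dζ.le hlamL, mul_nonneg hC_Jζ.le hlamL]
    rw [hsplit, h1, h2, h2']
    nlinarith
  -- (3) the Jensen count
  have htot : ∑ ρ ∈ Z, (D ρ : ℝ) ≤ (C_J + C_Jζ) * L' := by
    have hsplit : ∑ ρ ∈ Z, (D ρ : ℝ) = ∑ ρ ∈ Z, (D₁ ρ : ℝ) + ∑ ρ ∈ Z, (D₂ ρ : ℝ) := by
      rw [← Finset.sum_add_distrib]
      refine Finset.sum_congr rfl fun ρ _ => ?_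
      simp only [hD]; push_cast; ring
    have h1 : ∑ ρ ∈ Z, (D₁ ρ : ℝ) = ∑ ρ ∈ Z₁, (D₁ ρ : ℝ) := by
      symm
      apply Finset.sum_subset Finset.subset_union_left
      intro ρ _ hρ'; rw [hD₁0 ρ hρ']; simp
    have h1b : ∑ ρ ∈ Z₁, (D₁ ρ : ℝ) ≤ C_J * L' := by
      calc ∑ ρ ∈ Z₁, (D₁ ρ : ℝ) ≤ ∑ ρ ∈ Zχ, (discDivisor χ₁ v ρ : ℝ) := by
            refine (Finset.sum_le_sum_of_subset_of_nonneg hZ₁sub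
              fun ρ _ _ => by exact_mod_cast hD₁nn ρ).trans ?_
            exact Finset.sum_le_sum fun ρ _ => by exact_mod_cast hD₁le ρ
        _ ≤ C_J * (Real.log q₁ + Real.log (|v| + 4)) := hjensen q₁ χ₁ hχ₁ v
        _ ≤ C_J * L' := mul_le_mul_of_nonneg_left hLχ hC_J.le
    have h2 : ∑ ρ ∈ Z, (D₂ ρ : ℝ) = ∑ ρ' ∈ Zζ, (zetaDiscDivisor v ρ' : ℝ) := by
      have : ∑ ρ ∈ Z, (D₂ ρ : ℝ) = ∑ ρ ∈ Z₂, (D₂ ρ : ℝ) := by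
        symm
        apply Finset.sum_subset Finset.subset_union_right
        intro ρ _ hρ'; rw [hD₂0 ρ hρ']; simp
      rw [this, hZ₂, Finset.sum_image hinj]
      refine Finset.sum_congr rfl fun ρ' _ => ?_
      simp only [hD₂, sub_add_cancel]
    rw [hsplit, h1, h2]
    have e2 := (hjensenζ v).trans (mul_le_mul_of_nonneg_left hLv hC_Jζ.le)
    linarith
  -- (4) the Cauchy estimates, with the cancellation of `β₁` against the pole
  have hs₀mem : s₀ ∈ closedBall (2 + (v : ℂ) * I) (69 / 50) := by
    have := add_mem_closedBall_two (v := v) hr le_rfl (by linarith : r + 0 ≤ 1)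
    simpa [hs₀] using this
  have hs₁mem : s₀ + (δ₁ : ℂ) ∈ closedBall (2 + (v : ℂ) * I) (8 / 5) :=
    add_mem_closedBall_two_zeta hr hδ (by linarith)
  have hs₀re : s₀.re = 1 + r := by simp [hs₀]
  have hs₀re' : 1 < s₀.re := by rw [hs₀re]; linarith
  have hs₁re : (s₀ + (δ₁ : ℂ)).re = 1 + r + δ₁ := by simp [hs₀]
  have hs₁1 : s₀ + (δ₁ : ℂ) ≠ 1 := by
    intro h; have := congr_arg Complex.re h; rw [hs₁re, one_re] at this; linarith
  have hL0 : χ₁.LFunction s₀ ≠ 0 :=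
    DirichletCharacter.LFunction_ne_zero_of_one_le_re χ₁ (Or.inl hχ₁) hs₀re'.le
  have hL1 : riemannZeta₁ (s₀ + (δ₁ : ℂ)) ≠ 0 := fun h =>
    riemannZeta_ne_zero_of_one_le_re (by rw [hs₁re]; linarith)
      ((riemannZeta₁_eq_zero_iff hs₁1).1 h)
  -- the `β₁`-term of the partial fraction of `L'/L(s, χ₁)` and the subtracted pole term differ by
  -- at most `k! 16^k · 2`
  have hβterm : ∀ k : ℕ, ‖(-1 : ℂ) ^ k * k.factorial *
      ∑ ρ ∈ Zχ, ((discDivisor χ₁ v ρ - D₁ ρ : ℤ) : ℂ) / (s₀ - ρ) ^ (k + 1) -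
      (-1) ^ k * k.factorial * (1 / (s₀ - β₁) ^ (k + 1))‖ ≤ k.factorial * 16 ^ k * 2 := by
    intro k
    -- the sum is supported on `β₁`
    have hsum : ∑ ρ ∈ Zχ, ((discDivisor χ₁ v ρ - D₁ ρ : ℤ) : ℂ) / (s₀ - ρ) ^ (k + 1) =
        if β₁ ∈ Zχ then (discDivisor χ₁ v β₁ : ℂ) / (s₀ - β₁) ^ (k + 1) else 0 := by
      split_ifs with hmem
      · rw [← Finset.sum_erase_add _ _ hmem]
        have h0 : ∑ ρ ∈ Zχ.erase β₁, ((discDivisor χ₁ v ρ - D₁ ρ : ℤ) : ℂ) / (s₀ - ρ) ^ (k + 1) = 0 := by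
          refine Finset.sum_eq_zero fun ρ hρ => ?_
          have hne := (Finset.mem_erase.1 hρ).1
          simp only [hD₁, if_neg hne, sub_self, Int.cast_zero, zero_div]
        rw [h0, zero_add]
        simp only [hD₁, if_pos rfl, sub_zero]
      · refine Finset.sum_eq_zero fun ρ hρ => ?_
        have hne : ρ ≠ β₁ := fun h => hmem (h ▸ hρ)
        simp only [hD₁, if_neg hne, sub_self, Int.cast_zero, zero_div]
    rw [hsum]
    split_ifs with hmem
    · -- `β₁` in the disc: its multiplicity is `1`, exact cancellation
      obtain ⟨-, -, -, -, hdiv, hm⟩ := discZeros_prop hχ₁ hmem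
      have hm1 : zeroOrder χ₁ β₁ = 1 := le_antisymm hβsimple hm
      rw [hdiv, hm1]
      simp only [Nat.cast_one, Int.cast_one, one_div, sub_self, norm_zero]
      positivity
    · -- `β₁` outside the disc: `|s₀ − β₁| ≥ 1/2`
      rw [mul_zero, zero_sub, norm_neg]
      refine norm_poleTerm_le ?_ k
      have hout : ¬ (β₁ ∈ closedBall (2 + (v : ℂ) * I) (81 / 50)) := by
        intro hball; exact hmem ((mem_discZeros hχ₁).2 ⟨hball, hβzero⟩)
      rw [Metric.mem_closedBall, dist_eq_norm, not_le] at hout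
      have h1 : ‖s₀ - (2 + (v : ℂ) * I)‖ ≤ 1 := by
        have : s₀ - (2 + (v : ℂ) * I) = ((r - 1 : ℝ) : ℂ) := by rw [hs₀]; push_cast; ring
        rw [this, Complex.norm_real, Real.norm_eq_abs, abs_le]; constructor <;> linarith
      have h2 : ‖β₁ - (2 + (v : ℂ) * I)‖ ≤ ‖s₀ - β₁‖ + ‖s₀ - (2 + (v : ℂ) * I)‖ := by
        calc ‖β₁ - (2 + (v : ℂ) * I)‖ = ‖(s₀ - (2 + (v : ℂ) * I)) - (s₀ - β₁)‖ := by ring_nf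
          _ ≤ ‖s₀ - (2 + (v : ℂ) * I)‖ + ‖s₀ - β₁‖ := norm_sub_le _ _
          _ = _ := add_comm _ _
      linarith
  have hcauchy : ∀ k : ℕ, ‖a k - (-1) ^ k * k.factorial *
      ∑ ρ ∈ Z, (D ρ : ℂ) / (s₀ - ρ) ^ (k + 1)‖ ≤ k.factorial * 16 ^ k * ((C₁ + C₁ζ + 2) * L') := by
    intro k
    have hsplit : ∑ ρ ∈ Z, (D ρ : ℂ) / (s₀ - ρ) ^ (k + 1) =
        ∑ ρ ∈ Z, (D₁ ρ : ℂ) / (s₀ - ρ) ^ (k + 1) + ∑ ρ ∈ Z, (D₂ ρ : ℂ) / (s₀ - ρ) ^ (k + 1) := by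
      rw [← Finset.sum_add_distrib]
      refine Finset.sum_congr rfl fun ρ _ => ?_
      simp only [hD]; push_cast; ring
    -- the `D₁`-sum over `Z` equals the sum over `Zχ` (both vanish off `Z₁`)
    have h1 : ∑ ρ ∈ Z, (D₁ ρ : ℂ) / (s₀ - ρ) ^ (k + 1) =
        ∑ ρ ∈ Zχ, (D₁ ρ : ℂ) / (s₀ - ρ) ^ (k + 1) := by
      have e1 : ∑ ρ ∈ Z, (D₁ ρ : ℂ) / (s₀ - ρ) ^ (k + 1) =
          ∑ ρ ∈ Z₁, (D₁ ρ : ℂ) / (s₀ - ρ) ^ (k + 1) := by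
        symm
        apply Finset.sum_subset Finset.subset_union_left
        intro ρ _ hρ'; rw [hD₁0 ρ hρ']; simp
      have e2 : ∑ ρ ∈ Zχ, (D₁ ρ : ℂ) / (s₀ - ρ) ^ (k + 1) =
          ∑ ρ ∈ Z₁, (D₁ ρ : ℂ) / (s₀ - ρ) ^ (k + 1) := by
        symm
        apply Finset.sum_subset hZ₁sub
        intro ρ _ hρ'; rw [hD₁0 ρ hρ']; simp
      rw [e1, e2]
    have h1' : ∑ ρ ∈ Zχ, (D₁ ρ : ℂ) / (s₀ - ρ) ^ (k + 1) =
        ∑ ρ ∈ Zχ, (discDivisor χ₁ v ρ : ℂ) / (s₀ - ρ) ^ (k + 1) -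
        ∑ ρ ∈ Zχ, ((discDivisor χ₁ v ρ - D₁ ρ : ℤ) : ℂ) / (s₀ - ρ) ^ (k + 1) := by
      rw [← Finset.sum_sub_distrib]
      refine Finset.sum_congr rfl fun ρ _ => ?_
      push_cast; ring
    have h2 : ∑ ρ ∈ Z, (D₂ ρ : ℂ) / (s₀ - ρ) ^ (k + 1) =
        ∑ ρ' ∈ Zζ, (zetaDiscDivisor v ρ' : ℂ) / ((s₀ + (δ₁ : ℂ)) - ρ') ^ (k + 1) := by
      have : ∑ ρ ∈ Z, (D₂ ρ : ℂ) / (s₀ - ρ) ^ (k + 1) =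
          ∑ ρ ∈ Z₂, (D₂ ρ : ℂ) / (s₀ - ρ) ^ (k + 1) := by
        symm
        apply Finset.sum_subset Finset.subset_union_right
        intro ρ _ hρ'; rw [hD₂0 ρ hρ']; simp
      rw [this, hZ₂, Finset.sum_image hinj]
      refine Finset.sum_congr rfl fun ρ' _ => ?_
      simp only [hD₂, sub_add_cancel]
      congr 1
      ring
    have e1 := hderiv q₁ χ₁ hχ₁ v s₀ hs₀mem hL0 k
    have e2 := hderivζ v (s₀ + (δ₁ : ℂ)) hs₁mem hL1 k
    have e3 := hβterm k
    -- regroup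
    set E₁ := iteratedDeriv k (logDeriv χ₁.LFunction) s₀ -
      (-1) ^ k * k.factorial * ∑ ρ ∈ Zχ, (discDivisor χ₁ v ρ : ℂ) / (s₀ - ρ) ^ (k + 1) with hE₁
    set E₂ := iteratedDeriv k (logDeriv riemannZeta₁) (s₀ + (δ₁ : ℂ)) -
      (-1) ^ k * k.factorial *
        ∑ ρ' ∈ Zζ, (zetaDiscDivisor v ρ' : ℂ) / ((s₀ + (δ₁ : ℂ)) - ρ') ^ (k + 1) with hE₂
    set E₃ := (-1 : ℂ) ^ k * k.factorial *
      ∑ ρ ∈ Zχ, ((discDivisor χ₁ v ρ - D₁ ρ : ℤ) : ℂ) / (s₀ - ρ) ^ (k + 1) -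
      (-1) ^ k * k.factorial * (1 / (s₀ - β₁) ^ (k + 1)) with hE₃
    have hregroup : a k - (-1) ^ k * k.factorial * ∑ ρ ∈ Z, (D ρ : ℂ) / (s₀ - ρ) ^ (k + 1) =
        E₁ + E₂ + E₃ := by
      rw [hsplit, h1, h1', h2]
      simp only [ha, hE₁, hE₂, hE₃, hs₀δ]
      ring
    rw [hregroup]
    calc ‖E₁ + E₂ + E₃‖ ≤ ‖E₁‖ + ‖E₂‖ + ‖E₃‖ := norm_add₃_le
      _ ≤ k.factorial * 16 ^ k * (C₁ * (Real.log q₁ + Real.log (|v| + 4))) +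
            k.factorial * 16 ^ k * (C₁ζ * Real.log (|v| + 4)) + k.factorial * 16 ^ k * 2 :=
          add_le_add (add_le_add e1 e2) e3
      _ ≤ k.factorial * 16 ^ k * (C₁ * L') + k.factorial * 16 ^ k * (C₁ζ * L') +
            k.factorial * 16 ^ k * (2 * L') := by
          gcongr
          · have : (k.factorial : ℝ) * 16 ^ k * 2 * 1 ≤ k.factorial * 16 ^ k * 2 * L' :=
              mul_le_mul_of_nonneg_left hL'1 (by positivity)
            linarith
      _ = k.factorial * 16 ^ k * ((C₁ + C₁ζ + 2) * L') := by ring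
  -- (5) the given zero lies in `Z`
  have hzero' : ∃ ρ₀ ∈ Z, ‖ρ₀ - (1 + (v : ℂ) * I)‖ ≤ r := by
    obtain ⟨ρ₀, h0, hne, h0r⟩ := hzero
    exact ⟨ρ₀, Finset.mem_union_left _ (Finset.mem_erase.2 ⟨hne, h0⟩), h0r⟩
  have hDnn' : ∀ ρ, (0 : ℤ) ≤ D ρ := hDnn
  exact hA Z D a v r L' hr hr8 hu hDnn' hZprop hloc htot hcauchy hzero' K hK

/-- **Lemme B in the Deuring–Heilbronn case, configuration (D2)** (the exceptional character
itself): for `χ₁` real (`χ₁² = χ₀`, `χ₁ ≠ χ₀`) mod `q₁` with the simple real zero `1 − δ₁`,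
`0 ≤ δ₁`, `log q₁ + log(|v| + 4) ≤ L'`, `δ₁ L' ≤ 1`, `0 < r ≤ r₀`, `rL' ≥ 1`, a zero
`ρ₀ ≠ 1 − δ₁` of `L(s, χ₁)` with `|ρ₀ − (1 + iv)| ≤ r`, `log x ≥ A₀ L'`, `z ≤ x^{a₀/2}`:
`(e^{−10}/4) x^{−r/10}/r³ ≤ ∫_{⌊x^{a₀}⌋}^{x} ‖∑_{sifted n ≤ t} w₀(n) n^{−1−iv}‖² dt/t`,
`w₀ = Λ(χ₁ + n^{−δ₁})/2` with the trivial character mod `1`. [cite: Bombieri1987GrandCrible, §6 Lemme B] -/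
theorem lemmeB_D2 :
    ∃ A₀ r₀ : ℝ, 0 < A₀ ∧ 0 < r₀ ∧
      ∀ (q₁ : ℕ) [NeZero q₁] (χ₁ : DirichletCharacter ℂ q₁), χ₁ ^ 2 = 1 → χ₁ ≠ 1 →
      ∀ (δ₁ v r L' x : ℝ) (z : ℕ), 0 ≤ δ₁ → χ₁.LFunction ((1 - δ₁ : ℝ) : ℂ) = 0 →
        zeroOrder χ₁ ((1 - δ₁ : ℝ) : ℂ) ≤ 1 →
        Real.log q₁ + Real.log (|v| + 4) ≤ L' → δ₁ * L' ≤ 1 →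
        0 < r → r ≤ r₀ → 1 ≤ r * L' →
        (∃ ρ₀ ∈ discZeros χ₁ v, ρ₀ ≠ ((1 - δ₁ : ℝ) : ℂ) ∧ ‖ρ₀ - (1 + (v : ℂ) * I)‖ ≤ r) →
        0 < x → A₀ * L' ≤ Real.log x → (z : ℝ) ≤ x ^ (expoB / 2) →
          Real.exp (-10) / 4 * x ^ (-(r / 10)) / r ^ 3 ≤
            ∫ t in Set.Ioc (⌊x ^ expoB⌋₊ : ℝ) x,
              ‖summatory (coefSiftedW (dhW₀ χ₁ δ₁) (1 : DirichletCharacter ℂ 1) v x z) t‖ ^ 2 / t := by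
  obtain ⟨c₄, hc₄, hA⟩ := lemmeA_D2
  refine ⟨240 * (c₄ + 8 * Real.exp 14 + 8), min (1 / (112 * Real.exp 14)) (1 / 4096),
    by positivity, by positivity,
    fun q₁ _ χ₁ hχ₁sq hχ₁ δ₁ v r L' x z hδ hβzero hβsimple hL hδL hr hr0 hu hzero hx hlogx hz => ?_⟩
  have hw : ∀ n, |dhW₀ χ₁ δ₁ n| ≤ Λ n := fun n => abs_dhW₀_le χ₁ hδ n
  have hr1 : r ≤ 1 / (112 * Real.exp 14) := hr0.trans (min_le_left _ _)
  have hr2 : r ≤ 1 / 4096 := hr0.trans (min_le_right _ _)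
  have hr8 : 512 * r ≤ 1 / 8 := by linarith
  have h := lemmeB_generic hw (1 : DirichletCharacter ℂ 1) v (c₄ := c₄) (η := 2) (r := r)
    (L' := L') (x := x) (z := z) hc₄ (by norm_num) (by norm_num) hr hr1 hu hx hlogx hz ?_
  · calc Real.exp (-10) / 4 * x ^ (-(r / 10)) / r ^ 3
        = Real.exp (-10) / 2 ^ 2 * x ^ (-(r / 10)) / r ^ 3 := by norm_num
      _ ≤ _ := h
  · intro K hK
    obtain ⟨k, hk, hb⟩ := hA q₁ χ₁ hχ₁ δ₁ v r L' hδ hβzero hβsimple hL hδL hr hr8 hu hzero K hK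
    refine ⟨k, hk, ?_⟩
    rw [iteratedDeriv_add_D2 χ₁ hχ₁sq hδ v hr k] at hb
    exact hAout_of_mainTerm hr _ hb

/-- **The zero side of Théorème 14 (second assertion) for the exceptional character itself,
configuration (D2)**: there are absolute `A₀, r₀, C > 0` such that for `χ₁` real, `χ₁ ≠ χ₀`,
mod `q₁` with the simple real zero `1 − δ₁` (`0 ≤ δ₁`), `log q₁ + log(T' + 4) ≤ L'`, `δ₁ L' ≤ 1`,
`0 < r ≤ r₀`, `rL' ≥ 1`, `1 ≤ x`, `log x ≥ A₀ L'`, `z ≤ x^{a₀/2}`, and any finite set `Z` of zeros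
`ρ ≠ 1 − δ₁` of `L(s, χ₁)` with `1 − r/2 ≤ β < 1`, `|γ| + r/2 ≤ T'`:
`r · (e^{−10}/4) x^{−r/10} r^{−3} · ∑_{ρ ∈ Z} m(ρ) ≤ C (rL') ∫_{−T'}^{T'} I_{w₀,χ₀}(v) dv`.
[cite: Bombieri1987GrandCrible, §6 Théorème 14 (proof)] -/
theorem zeroSide_D2 :
    ∃ A₀ r₀ C : ℝ, 0 < A₀ ∧ 0 < r₀ ∧ 0 < C ∧
      ∀ (q₁ : ℕ) [NeZero q₁] (χ₁ : DirichletCharacter ℂ q₁), χ₁ ^ 2 = 1 → χ₁ ≠ 1 →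
      ∀ (δ₁ T' r L' x : ℝ) (z : ℕ) (Zρ : Finset ℂ), 0 ≤ δ₁ →
        χ₁.LFunction ((1 - δ₁ : ℝ) : ℂ) = 0 → zeroOrder χ₁ ((1 - δ₁ : ℝ) : ℂ) ≤ 1 →
        Real.log q₁ + Real.log (T' + 4) ≤ L' → δ₁ * L' ≤ 1 →
        0 < r → r ≤ r₀ → 1 ≤ r * L' → 1 ≤ x →
        A₀ * L' ≤ Real.log x → (z : ℝ) ≤ x ^ (expoB / 2) → 0 ≤ T' →
        (∀ ρ ∈ Zρ, χ₁.LFunction ρ = 0 ∧ ρ ≠ ((1 - δ₁ : ℝ) : ℂ) ∧ 1 - r / 2 ≤ ρ.re ∧ ρ.re < 1 ∧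
          |ρ.im| + r / 2 ≤ T') →
          r * (Real.exp (-10) / 4 * x ^ (-(r / 10)) / r ^ 3) * ∑ ρ ∈ Zρ, (zeroOrder χ₁ ρ : ℝ) ≤
            C * (r * L') *
              ∫ v in (-T')..T', meanValueW (dhW₀ χ₁ δ₁) (1 : DirichletCharacter ℂ 1) x z v := by
  obtain ⟨A₀, r₀, hA₀, hr₀, hB⟩ := lemmeB_D2
  obtain ⟨C_d, hC_d, hdens⟩ := exists_sum_near_le
  refine ⟨A₀, min r₀ (1 / 4), 2 * C_d, hA₀, by positivity, by positivity,
    fun q₁ _ χ₁ hχ₁sq hχ₁ δ₁ T' r L' x z Zρ hδ hβzero hβsimple hLL' hδL hr hrmin hu hx hlogx hz hT'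
      hZ => ?_⟩
  classical
  have hw : ∀ n, |dhW₀ χ₁ δ₁ n| ≤ Λ n := fun n => abs_dhW₀_le χ₁ hδ n
  have hr0 : r ≤ r₀ := hrmin.trans (min_le_left _ _)
  have hr4 : r ≤ 1 / 4 := hrmin.trans (min_le_right _ _)
  set L₀ : ℝ := Real.exp (-10) / 4 * x ^ (-(r / 10)) / r ^ 3 with hL₀
  set A : Set ℝ := Set.Icc (-T') T' with hA
  have hxpos : 0 < x := by linarith
  have hNX : 1 ≤ ⌊x ^ expoB⌋₊ := Nat.le_floor (by
    simp only [Nat.cast_one]; exact Real.one_le_rpow hx expoB_pos.le)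
  have hint : IntegrableOn (meanValueW (dhW₀ χ₁ δ₁) (1 : DirichletCharacter ℂ 1) x z) A :=
    integrableOn_meanValueW hw _ hx z hNX _ _
  have hLB : ∀ ρ ∈ Zρ, ∀ v ∈ Set.Icc (ρ.im - r / 2) (ρ.im + r / 2),
      L₀ ≤ meanValueW (dhW₀ χ₁ δ₁) (1 : DirichletCharacter ℂ 1) x z v := by
    intro ρ hρ v hv
    obtain ⟨h0, hne, hβ, hβ1, hγT⟩ := hZ ρ hρ
    rw [Set.mem_Icc] at hv
    have hvT : |v| ≤ T' := by
      have h1 : |ρ.im| ≤ T' - r / 2 := by linarith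
      have h2 := abs_le.1 h1
      rw [abs_le]; constructor <;> linarith
    have hLL'v : Real.log q₁ + Real.log (|v| + 4) ≤ L' := by
      have := Real.log_le_log (by positivity) (show |v| + 4 ≤ T' + 4 by linarith)
      linarith
    have hγ : |ρ.im - v| ≤ r / 2 := by
      rw [abs_le]; constructor <;> linarith
    have hnorm : ‖ρ - (1 + (v : ℂ) * I)‖ ≤ r := by
      have hre : (ρ - (1 + (v : ℂ) * I)).re = ρ.re - 1 := by simp
      have him : (ρ - (1 + (v : ℂ) * I)).im = ρ.im - v := by simp
      calc ‖ρ - (1 + (v : ℂ) * I)‖ ≤ |(ρ - (1 + (v : ℂ) * I)).re| + |(ρ - (1 + (v : ℂ) * I)).im| :=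
            Complex.norm_le_abs_re_add_abs_im _
        _ ≤ r / 2 + r / 2 := by
            rw [hre, him]
            refine add_le_add ?_ hγ
            rw [abs_sub_comm, abs_of_nonneg (by linarith)]; linarith
        _ = r := by ring
    have hdisc : ρ ∈ discZeros χ₁ v := by
      refine (mem_discZeros hχ₁).2 ⟨?_, h0⟩
      rw [Metric.mem_closedBall, dist_eq_norm]
      calc ‖ρ - (2 + (v : ℂ) * I)‖ = ‖(ρ - (1 + (v : ℂ) * I)) - 1‖ := by ring_nf
        _ ≤ ‖ρ - (1 + (v : ℂ) * I)‖ + ‖(1 : ℂ)‖ := norm_sub_le _ _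
        _ ≤ r + 1 := by rw [norm_one]; linarith
        _ ≤ 81 / 50 := by linarith
    exact hB q₁ χ₁ hχ₁sq hχ₁ δ₁ v r L' x z hδ hβzero hβsimple hLL'v hδL hr hr0 hu
      ⟨ρ, hdisc, hne, hnorm⟩ hxpos hlogx hz
  have hper : ∀ ρ ∈ Zρ, r * L₀ ≤
      ∫ v in A, (Set.Icc (ρ.im - r / 2) (ρ.im + r / 2)).indicator
        (meanValueW (dhW₀ χ₁ δ₁) (1 : DirichletCharacter ℂ 1) x z) v := by
    intro ρ hρ
    obtain ⟨-, -, -, -, hγT⟩ := hZ ρ hρ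
    set J : Set ℝ := Set.Icc (ρ.im - r / 2) (ρ.im + r / 2) with hJ
    have hJA : J ⊆ A := by
      intro v hv
      rw [hJ, Set.mem_Icc] at hv
      rw [hA, Set.mem_Icc]
      have h1 : |ρ.im| ≤ T' - r / 2 := by linarith
      have h2 := abs_le.1 h1
      constructor <;> linarith
    rw [setIntegral_indicator measurableSet_Icc, Set.inter_eq_right.2 hJA]
    have hvol : volume.real J = r := by
      rw [hJ, Measure.real, Real.volume_Icc, ENNReal.toReal_ofReal (by linarith)]; ring
    have h := setIntegral_ge_of_const_le_real (c := L₀) measurableSet_Icc measure_Icc_lt_top.ne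
      (fun v hv => hLB ρ hρ v hv) (hint.mono_set hJA)
    rw [hvol] at h
    linarith
  have hsum : r * L₀ * ∑ ρ ∈ Zρ, (zeroOrder χ₁ ρ : ℝ) ≤
      ∫ v in A, ∑ ρ ∈ Zρ, (zeroOrder χ₁ ρ : ℝ) *
        (Set.Icc (ρ.im - r / 2) (ρ.im + r / 2)).indicator
          (meanValueW (dhW₀ χ₁ δ₁) (1 : DirichletCharacter ℂ 1) x z) v := by
    rw [mul_sum, integral_finsetSum _ fun ρ _ => (hint.indicator measurableSet_Icc).const_mul _]
    refine sum_le_sum fun ρ hρ => ?_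
    rw [integral_const_mul]
    have h0 : (0 : ℝ) ≤ zeroOrder χ₁ ρ := Nat.cast_nonneg _
    calc r * L₀ * (zeroOrder χ₁ ρ : ℝ) = (zeroOrder χ₁ ρ : ℝ) * (r * L₀) := by ring
      _ ≤ _ := mul_le_mul_of_nonneg_left (hper ρ hρ) h0
  refine hsum.trans ?_
  have hℒ : ∀ v ∈ A, Real.log q₁ + Real.log (|v| + 4) ≤ L' := by
    intro v hv
    rw [hA, Set.mem_Icc] at hv
    have hvT : |v| ≤ T' := abs_le.2 ⟨hv.1, hv.2⟩
    have := Real.log_le_log (by positivity) (show |v| + 4 ≤ T' + 4 by linarith)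
    linarith
  have hpt : ∀ v ∈ A, ∑ ρ ∈ Zρ, (zeroOrder χ₁ ρ : ℝ) *
      (Set.Icc (ρ.im - r / 2) (ρ.im + r / 2)).indicator
        (meanValueW (dhW₀ χ₁ δ₁) (1 : DirichletCharacter ℂ 1) x z) v ≤
        (2 * C_d * (r * L')) * meanValueW (dhW₀ χ₁ δ₁) (1 : DirichletCharacter ℂ 1) x z v := by
    intro v hv
    have heq : ∑ ρ ∈ Zρ, (zeroOrder χ₁ ρ : ℝ) *
        (Set.Icc (ρ.im - r / 2) (ρ.im + r / 2)).indicator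
          (meanValueW (dhW₀ χ₁ δ₁) (1 : DirichletCharacter ℂ 1) x z) v =
        (∑ ρ ∈ Zρ.filter (fun ρ => |ρ.im - v| ≤ r / 2), (zeroOrder χ₁ ρ : ℝ)) *
          meanValueW (dhW₀ χ₁ δ₁) (1 : DirichletCharacter ℂ 1) x z v := by
      rw [sum_mul, sum_filter]
      refine sum_congr rfl fun ρ _ => ?_
      by_cases h : |ρ.im - v| ≤ r / 2
      · rw [if_pos h, Set.indicator_of_mem]
        rw [Set.mem_Icc]; rw [abs_le] at h; constructor <;> linarith
      · rw [if_neg h, Set.indicator_of_notMem, mul_zero]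
        rw [Set.mem_Icc]; intro h'; exact h (abs_le.2 ⟨by linarith, by linarith⟩)
    rw [heq]
    refine mul_le_mul_of_nonneg_right ?_ (meanValueW_nonneg _ _ x z v)
    have h1 := overlap_le hdens χ₁ hχ₁ hr hr4 Zρ
      (fun ρ hρ => ⟨(hZ ρ hρ).1, (hZ ρ hρ).2.2.1, (hZ ρ hρ).2.2.2.1⟩) v
    have h2 : C_d * (1 + r * (Real.log q₁ + Real.log (|v| + 4))) ≤ 2 * C_d * (r * L') := by
      have := hℒ v hv
      have h3 : r * (Real.log q₁ + Real.log (|v| + 4)) ≤ r * L' :=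
        mul_le_mul_of_nonneg_left this hr.le
      nlinarith [hC_d, hu]
    exact h1.trans h2
  have hi1 : IntegrableOn (fun v => ∑ ρ ∈ Zρ, (zeroOrder χ₁ ρ : ℝ) *
      (Set.Icc (ρ.im - r / 2) (ρ.im + r / 2)).indicator
        (meanValueW (dhW₀ χ₁ δ₁) (1 : DirichletCharacter ℂ 1) x z) v) A :=
    integrable_finsetSum _ fun ρ _ => (hint.indicator measurableSet_Icc).const_mul _
  calc ∫ v in A, ∑ ρ ∈ Zρ, (zeroOrder χ₁ ρ : ℝ) *
        (Set.Icc (ρ.im - r / 2) (ρ.im + r / 2)).indicator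
          (meanValueW (dhW₀ χ₁ δ₁) (1 : DirichletCharacter ℂ 1) x z) v
      ≤ ∫ v in A, (2 * C_d * (r * L')) * meanValueW (dhW₀ χ₁ δ₁) (1 : DirichletCharacter ℂ 1) x z v :=
        setIntegral_mono_on hi1 (hint.const_mul _) measurableSet_Icc hpt
    _ = (2 * C_d * (r * L')) *
        ∫ v in (-T')..T', meanValueW (dhW₀ χ₁ δ₁) (1 : DirichletCharacter ℂ 1) x z v := by
        rw [integral_const_mul, hA, integral_Icc_eq_integral_Ioc,
          ← intervalIntegral.integral_of_le (by linarith)]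

end Literature.NumberTheory.LFunctions.LogFreeDensity
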